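import Summits.HodgeConjecture.HodgeConjecture.Cruxes.BlochSeedDiscOne.DepthBoundA4
import Summits.HodgeConjecture.HodgeConjecture.Cruxes.BlochSeedDiscOne.LeggedFloor

/-!
# BOX IDENTITY at every ring (plan-lens-HodgeAV-negation g21 → v3 g22; director-hodge R19.683 (S3-2), R19.688 (D-A′)) — the SLAB LEMMA,
# the BOX IDENTITY, the BRANCH-B CHARGE BOUND, and (v3) the SUPPLIER SHADOW LAW ∕ FOUR-PER-BOX LAW ∕ FACE IDENTITIES of the pair ∕ box
# argument, HEIGHT-FREE, as kernel theorems over `DepthBoundA4`'s letter model (+ `LeggedFloor`'s RULE D text as a hypothesis in §11)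

line stmt-HodgeConjecture-18881 Cruxes/BlochSeedDiscOne/Lines/birth.lean 814a6a70c14e831a stub_rung_pad4_seedAt

CENSUS-NEUTRAL.  Letter-model class arithmetic only (`DepthBoundA4`'s `Letter`, `Design`, `Design.T`, `Design.mu`, `linZ`); §11 takes
`LeggedFloor`'s `RuleD` (N-side clause) and `Disj` as HYPOTHESES and proves nothing about them; no Hall ∕ budget statement, no sheaf, no SEED;
NOTHING here is proved toward HC ∕ HC_CM ∕ HC_AV ∕ №4 ∕ 26512 ∕ 18881 ∕ 30548 ∕ H2.  HC_CM is not mentioned.  v3 = v2 (abb07ae99d169986,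
91 declarations, unchanged byte-for-byte below the header) + §11 + §12 (memo `FOURFOLD-negation-g22.md` 5fb10aa33e706793 §1, §2 (2a), §4).
This is the typed form of §1 (1b)(1c)(1e) of `RING3-FACE-negation-g21.md` (v1.1 8ee4e7241debcdd8) = items L4∕L5 of the shell-2 BB-pair memo
`BBPAIR-LAW-negation-g21.md` (v1.2 ed57fd251ca5977c), now for EVERY height `hgt` and every ring at once.  §1 (weight tables, `expand`) is REPEATED
VERBATIM from monad-1 g14's `ChargeIdealLaw.lean` §1 ∕ s4-search-1 g36's `XYMomentLaw.lean` §1 (credit: those files), and §3's `ipow` from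
`XYMomentLaw` §3, so that this file elaborates from `DepthBoundA4` alone (one writer per file; nothing of dual g15 ∕ strengthen g17 ∕ s4 g36 is restated
as mine — s4's `xy_moment_law` is the pure-e∕ē sibling of `box_identity` below, with the table `tw` in place of `bx`).

WHAT IS PROVED (no `decide` on designs, no `native_decide`, no axiom ∕ sorry ∕ instance ∕ notation):
* `slab hgt t ℓ = (hgt − a) − s_t(ℓ)`, `s_t = x + y, y − x, −x − y, x − y` (`t = 0,1,2,3`; `s_t = Re((1 − i)·i^{−t}·β)`);
  `slab_nonneg : ℓ.OnAlphabet hgt → 0 ≤ slab hgt t ℓ` (the taxicab identity `|x| + |y| = hgt − a`), `slab_hub : slab hgt t (hub hgt) = 0`,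
  `slab_zero_iff : slab = 0 ↔ β in the closed quadrant i^t·Q` (on the alphabet).
* `box_identity (D) (hA : A1e D) (x : Fin 4 → Fin 4) : 2 * Psi hgt x D = 2 * Sigma hgt D - (ipow (wt x) * D.mu).re`
  — for EVERY integer design with CLAUSE 1 of (A1) and every height: `Ψ_x(D) := Σ_N m·ψ_x − Σ_P m·ψ_x`, `ψ_x(c) = ∏_f slab_(x_f)(c_f)`,
  `Σ(D) := Σ_N m·ρ − Σ_P m·ρ`, `ρ(c) = ∏_f (hgt − a_f)` (`= T(C⊗⁴)`, `C = hgt·1 − h`), `|x| = Σ_f x_f (mod 4)`; i.e. `Σ_c (m_N − m_P)ψ_x = σ + 2Re(B̄_x μ)`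
  with `B_x = −¼ i^{−|x|}` — the BOX IDENTITY of the memo with the same constants, alphabet-free.
* `linZP_psi_nonneg : D.OnAlphabet hgt → 0 ≤ Σ_P m·ψ_x` (slab lemma, factorwise).
* BRANCH B: `KilledN hgt D d x := ∀ t, Σ_N m·ψ_(x[d ↦ t]) = 0` (the N side is killed by the 3-box `(x_f)_(f ≠ d)` for all four phases at the
  dropped slot `d`); `killedN_of_threeBox` = the memo's wording (every N-support cell has a kept slot `f ≠ d` with `slab_(x_f) = 0`, or a hub at `d`).
  `branchB_bound : D.OnAlphabet hgt → A1e D → KilledN hgt D d x → 2 * Sigma hgt D + |Re μ| ≤ 0 ∧ 2 * Sigma hgt D + |Im μ| ≤ 0`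
  (so `σ ≤ −max(|Re μ|, |Im μ|)∕2 ≤ −|μ|∕(2√2)`), `sigma_neg_of_killedN : … → μ ≠ 0 → Sigma hgt D < 0`, and the dichotomy's use
  `not_killedN_of_sigma_nonneg : … → μ ≠ 0 → 0 ≤ Sigma hgt D → ¬ KilledN hgt D d x` (BRANCH A is forced as soon as `σ ≥ 0`; at shell 2 under
  dual g15's `door_law` one has `σ = −4k = 0`).
* §9 LATTICE LAW (every height; clause 1 + alphabet): `slab_even`, `psi_dvd_sixteen`, `Psi_dvd_sixteen`, and
  `lattice_sixteen : D.OnAlphabet hgt → A1e D → 16 ∣ Re μ ∧ 16 ∣ Im μ ∧ 32 ∣ Re μ + Im μ ∧ 32 ∣ 2σ − Re μ` (`μ ∈ 16(1+i)ℤ[i]`,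
  `σ ≡ Re μ∕2 (mod 16)`, `eight_dvd_sigma`; anomaly g16's candidate lattice (S3-5), sharpening s4's `eight_dvd_charge`), and
  `sigma_le_neg_eight_of_killedN` (BRANCH B costs `σ ≤ −8`).
* §10 COVERING DICHOTOMY (every height): `exists_good_class`, `classA_content ∕ classA_Nmass ∕ classA_meets` (BRANCH A′: on all 64 boxes
  of one phase class, `Σ_N m·ψ_x ≥ 16 + Σ_P m·ψ_x` — the F⁺-site law of every ring), `classB_content ∕ classB_Pmass ∕ classB_meets`
  (BRANCH B′: the P side meets all 64 boxes of the opposite class and `σ ≤ −8`), `covering_dichotomy` (A′ ∨ B′ for every charged design),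
  `classA_of_sigma_gt` (`σ > −8 ⇒ A′`).
* §11 SUPPLIER SHADOW LAW and FOUR-PER-BOX (v3; hypotheses: alphabet, clause 1, P support inside shell 4, `RuleD`, `Disj`):
  `axis_of_sq_add_sq` (a Pythagorean step of length `≤ 4` is axis-parallel: `1, 4, 9, 16` are not sums of two positive squares),
  `slab_le_of_nullStep` (a NULL step of length `≤ 4` does not increase any of the four slabs), `psi_le_of_supplies` (`Supplies x y g j`,
  `x` inside shell 4 ⇒ `ψ_t(y) ≤ ψ_t(x)` at EVERY box: a supplier is alive wherever the supplied cell is, with at least its weight),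
  `detects_of_psi_pos`, `three_suppliers` (`RuleD ∧ Disj` ⇒ an all-detecting N-support cell has `≥ 3` pairwise DISTINCT P suppliers),
  `linZP_psi_ge_three` (`W_P(t) ≥ 3·ψ_t(y)` for every N-support cell `y`, every box), `perBox_law` (`2W_N(t) ≥ 6ψ_t(y) + 2σ − Re(i^{|t|}μ)`),
  `linZP_of_Ndead`, `classA_Nmass_three` (BRANCH A′: `W_N(x) ≥ 16 + 3ψ_x(y)`), `aliveN` + `four_per_box` (BRANCH A′: at least FOUR N copies
  alive on every box of the good class), `aliveN_law` (any box: `2w*·M_N ≥ 6w* + 2σ − Re(i^{|x|}μ)`).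
* §12 FACE IDENTITIES (v3; clause 1 only): for a PROPER face `F` (some free slot) and ANY phase vector `x`,
  `face_identity : PsiF hgt F x D = SigmaF hgt F D` — `Σ_N m·ψ^F_x − Σ_P m·ψ^F_x = Σ_N m·ρ^F − Σ_P m·ρ^F`, `μ`-FREE and PHASE-FREE
  (`face_phase_free`), mass form `face_Nmass`; `psiF_top` (the full mask is `ψ_x`, where the Bloch term of `box_identity` reappears).
READING (not formalised here): at shell 2 `Sigma 14 D = F̂(0) = m_N(u⁴) − m_P(u⁴) − 2·m_P(A-hooks) = −4k`; at shell 3 `σ₃ = 4Δ(BB) + 8Δ(BD) + 16Δ(DD)`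
(`bbpair_law` face, dual ∕ strengthen); the missing shell-3 input is an upper bound on the P-side pair mass at one slot pair under the door (memo v1.1 §5).
-/

set_option linter.dupNamespace false
set_option autoImplicit false

namespace Summit.HodgeConjecture.HodgeConjecture.Cruxes.BlochSeedDiscOne.BoxIdentity

open Summit.HodgeConjecture.HodgeConjecture.Cruxes.BlochSeedDiscOne.DepthBoundA4
open Summit.HodgeConjecture.HodgeConjecture.Cruxes.BlochSeedDiscOne.LeggedFloor (NullStep Supplies Detects RuleD Disj)

/-! ## §0 Clause 1 of (A1) (as in `ChargeIdealLaw` ∕ `XYMomentLaw` §0) -/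

/-- CLAUSE 1 of the tree's `Design.A1`: every e-mixed word other than `eeee` ∕ `ēēēē` has tensor coefficient `0`. -/
def A1e (D : Design) : Prop :=
  ∀ w : Word, ¬ w.efree → w ≠ Word.eeee → w ≠ Word.EEEE → D.T w = 0

theorem a1e_of_a1 (D : Design) (h : D.A1) : A1e D := h.1

/-! ## §1 Weight tables and the multilinear expansion (verbatim from `ChargeIdealLaw` §1 ∕ `XYMomentLaw` §1) -/

/-- A weight table: one Gaussian weight per (factor, symbol). -/
abbrev Tab := Fin 4 → Sym → GaussianInt

/-- Word weight `λ_w = ∏_f L f (w f)`. -/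
def lamW (L : Tab) (w : Word) : GaussianInt := ∏ f : Fin 4, L f (w f)

/-- Letter functional `G_f(ℓ) = Σ_s L f s · coef s ℓ`. -/
def G (L : Tab) (f : Fin 4) (ℓ : Letter) : GaussianInt := ∑ s : Sym, L f s * s.coef ℓ

/-- Per-cell expansion: `Σ_w λ_w · cellCoef c w = ∏_f G_f(c_f)`. -/
theorem cell_expand (L : Tab) (c : Cell) :
    ∑ w : Word, lamW L w * cellCoef c w = ∏ f : Fin 4, G L f (c f) := by
  unfold G
  rw [Finset.prod_univ_sum, Fintype.piFinset_univ]
  refine Finset.sum_congr rfl fun w _ => ?_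
  unfold lamW cellCoef
  rw [← Finset.prod_mul_distrib]

/-- Weighted list sum `Σ m · φ(cell)`. -/
def wsum (Lst : List (Cell × ℕ)) (φ : Cell → GaussianInt) : GaussianInt :=
  (Lst.map fun cm => (cm.2 : GaussianInt) * φ cm.1).sum

theorem wsum_nil (φ : Cell → GaussianInt) : wsum [] φ = 0 := by simp [wsum]

theorem wsum_cons (a : Cell × ℕ) (t : List (Cell × ℕ)) (φ : Cell → GaussianInt) :
    wsum (a :: t) φ = (a.2 : GaussianInt) * φ a.1 + wsum t φ := by simp [wsum]

theorem T_eq_wsum (D : Design) (w : Word) :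
    D.T w = wsum D.N (fun c => cellCoef c w) - wsum D.P (fun c => cellCoef c w) := rfl

theorem sum_mul_wsum (Lst : List (Cell × ℕ)) (a : Word → GaussianInt) (φ : Word → Cell → GaussianInt) :
    ∑ w : Word, a w * wsum Lst (φ w) = wsum Lst (fun c => ∑ w : Word, a w * φ w c) := by
  induction Lst with
  | nil => simp [wsum_nil]
  | cons hd tl ih =>
    simp only [wsum_cons, mul_add, Finset.sum_add_distrib, ih, Finset.mul_sum]
    congr 1
    exact Finset.sum_congr rfl fun w _ => by ring

/-- THE EXPANSION: `Σ_w λ_w T(D)(w) = Σ_N m ∏_f G_f − Σ_P m ∏_f G_f`. -/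
theorem expand (L : Tab) (D : Design) :
    ∑ w : Word, lamW L w * D.T w
      = wsum D.N (fun c => ∏ f : Fin 4, G L f (c f)) - wsum D.P (fun c => ∏ f : Fin 4, G L f (c f)) := by
  simp only [T_eq_wsum, mul_sub, Finset.sum_sub_distrib]
  rw [sum_mul_wsum, sum_mul_wsum]
  simp only [cell_expand]

/-! ## §2 The e-free truncation of a table and the SPLIT of the word side under clause 1 -/

/-- The e-free TRUNCATION `L⁰` of a table (`e, ē ↦ 0`, e-free symbols kept). -/
def trunc (L : Tab) : Tab := fun f s => if s.efree = true then L f s else 0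

theorem lamW_trunc_of_efree (L : Tab) (w : Word) (hw : w.efree) : lamW (trunc L) w = lamW L w := by
  unfold lamW trunc
  exact Finset.prod_congr rfl fun f _ => by simp [hw f]

theorem lamW_trunc_of_not_efree (L : Tab) (w : Word) (hw : ¬ w.efree) : lamW (trunc L) w = 0 := by
  unfold Word.efree at hw
  push Not at hw
  obtain ⟨f, hf⟩ := hw
  unfold lamW
  apply Finset.prod_eq_zero (Finset.mem_univ f)
  simp [trunc, hf]

theorem eeee_ne_EEEE : Word.eeee ≠ Word.EEEE := by decide

theorem eeee_not_efree : ¬ Word.eeee.efree := fun h => by simpa [Word.eeee, Sym.efree] using h 0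

theorem EEEE_not_efree : ¬ Word.EEEE.efree := fun h => by simpa [Word.EEEE, Sym.efree] using h 0

/-- THE SPLIT: under clause 1, `Σ_w λ_w T(w) = Σ_w λ⁰_w T(w) + λ_eeee·T(eeee) + λ_ēēēē·T(ēēēē)` (e-free words go to the truncation,
the two Bloch words survive, every other e-mixed word is killed by clause 1). -/
theorem split (L : Tab) (D : Design) (hA : A1e D) :
    ∑ w : Word, lamW L w * D.T w
      = ∑ w : Word, lamW (trunc L) w * D.T w
        + lamW L Word.eeee * D.T Word.eeee + lamW L Word.EEEE * D.T Word.EEEE := by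
  have key : ∀ w : Word, lamW L w * D.T w =
      lamW (trunc L) w * D.T w +
      ((if w = Word.eeee then lamW L Word.eeee * D.T Word.eeee else 0) +
       (if w = Word.EEEE then lamW L Word.EEEE * D.T Word.EEEE else 0)) := by
    intro w
    by_cases he : w.efree
    · have h1 : w ≠ Word.eeee := fun h => eeee_not_efree (h ▸ he)
      have h2 : w ≠ Word.EEEE := fun h => EEEE_not_efree (h ▸ he)
      simp [h1, h2, lamW_trunc_of_efree L w he]
    · rw [lamW_trunc_of_not_efree L w he, zero_mul, zero_add]
      by_cases h1 : w = Word.eeee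
      · subst h1
        simp [eeee_ne_EEEE]
      by_cases h2 : w = Word.EEEE
      · subst h2
        simp [eeee_ne_EEEE.symm]
      · simp [h1, h2, hA w he h1 h2]
  rw [Finset.sum_congr rfl fun w _ => key w, Finset.sum_add_distrib, Finset.sum_add_distrib,
    Finset.sum_ite_eq', Finset.sum_ite_eq']
  simp [add_assoc]

/-! ## §3 Gaussian constants (`ipow` as in `XYMomentLaw` §3) -/

/-- `i^k ∈ ℤ[i]` for `k : Fin 4`. -/
def ipow : Fin 4 → GaussianInt
  | 0 => 1
  | 1 => ⟨0, 1⟩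
  | 2 => -1
  | 3 => ⟨0, -1⟩

theorem ipow_mul (a b : Fin 4) : ipow a * ipow b = ipow (a + b) := by
  fin_cases a <;> fin_cases b <;> decide

theorem star_ipow (a : Fin 4) : star (ipow a) = ipow (-a) := by
  fin_cases a <;> decide

/-- `1 + i`. -/
def opi : GaussianInt := ⟨1, 1⟩

/-- `1 − i`. -/
def omi : GaussianInt := ⟨1, -1⟩

theorem opi_pow4 : opi * opi * opi * opi = -4 := by decide

theorem omi_pow4 : omi * omi * omi * omi = -4 := by decide

/-! ## §4 The SLAB functional and the BOX slot table -/

/-- `s_t(ℓ) = Re((1 − i)·i^{−t}·β)`: `x + y, y − x, −x − y, x − y` for `t = 0, 1, 2, 3`. -/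
def spro (t : Fin 4) (ℓ : Letter) : ℤ :=
  match t with
  | 0 => ℓ.x + ℓ.y
  | 1 => ℓ.y - ℓ.x
  | 2 => -ℓ.x - ℓ.y
  | 3 => ℓ.x - ℓ.y

/-- The SLAB functional at phase `t`: `slab_t(ℓ) = (hgt − a) − s_t(ℓ)` (`= r(ℓ) − s_t(ℓ)` on the height-`hgt` alphabet, `r = |x| + |y|`). -/
def slab (hgt : ℤ) (t : Fin 4) (ℓ : Letter) : ℤ := (hgt - ℓ.a) - spro t ℓ

/-- **SLAB LEMMA.** On the height-`hgt` alphabet every slab value is `≥ 0` (taxicab identity `|x| + |y| = hgt − a`). -/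
theorem slab_nonneg (hgt : ℤ) (t : Fin 4) (ℓ : Letter) (hℓ : ℓ.OnAlphabet hgt) : 0 ≤ slab hgt t ℓ := by
  obtain ⟨hh, -⟩ := hℓ
  unfold Letter.height at hh
  have hx := le_abs_self ℓ.x
  have hx' := neg_abs_le ℓ.x
  have hy := le_abs_self ℓ.y
  have hy' := neg_abs_le ℓ.y
  fin_cases t <;> simp [slab, spro] <;> omega

/-- The hub `(hgt; 0, 0)` has all four slabs `= 0` (an `H` letter kills every box it sits in). -/
theorem slab_hub (hgt : ℤ) (t : Fin 4) : slab hgt t (Letter.hub hgt) = 0 := by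
  fin_cases t <;> simp [slab, spro, Letter.hub]

/-- `slab_t(ℓ) = 0` iff `β(ℓ)` lies in the CLOSED quadrant `i^t·Q` (on the alphabet). -/
theorem slab_zero_iff (hgt : ℤ) (ℓ : Letter) (hℓ : ℓ.OnAlphabet hgt) :
    (slab hgt 0 ℓ = 0 ↔ 0 ≤ ℓ.x ∧ 0 ≤ ℓ.y) ∧ (slab hgt 1 ℓ = 0 ↔ ℓ.x ≤ 0 ∧ 0 ≤ ℓ.y) ∧
    (slab hgt 2 ℓ = 0 ↔ ℓ.x ≤ 0 ∧ ℓ.y ≤ 0) ∧ (slab hgt 3 ℓ = 0 ↔ 0 ≤ ℓ.x ∧ ℓ.y ≤ 0) := by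
  obtain ⟨hh, -⟩ := hℓ
  unfold Letter.height at hh
  rcases abs_cases ℓ.x with ⟨hx, hx0⟩ | ⟨hx, hx0⟩ <;> rcases abs_cases ℓ.y with ⟨hy, hy0⟩ | ⟨hy, hy0⟩ <;>
    simp [slab, spro] <;> omega

/-- Sanity (memo §1 (1b), height 14): slab values `(t = 0,1,2,3)` of `u = (13; 1, 0)`, `B = (12; 1, 1)`, `C = (11; 3, 0)`,
`D = (11; 2, 1)`, `D' = (11; 1, 2)`: `(0,2,2,0)`, `(0,2,4,2)`, `(0,6,6,0)`, `(0,4,6,2)`, `(0,2,6,4)`. -/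
example : (slab 14 0 ⟨13, 1, 0⟩, slab 14 1 ⟨13, 1, 0⟩, slab 14 2 ⟨13, 1, 0⟩, slab 14 3 ⟨13, 1, 0⟩) = (0, 2, 2, 0) := by decide
example : (slab 14 0 ⟨12, 1, 1⟩, slab 14 1 ⟨12, 1, 1⟩, slab 14 2 ⟨12, 1, 1⟩, slab 14 3 ⟨12, 1, 1⟩) = (0, 2, 4, 2) := by decide
example : (slab 14 0 ⟨11, 3, 0⟩, slab 14 1 ⟨11, 3, 0⟩, slab 14 2 ⟨11, 3, 0⟩, slab 14 3 ⟨11, 3, 0⟩) = (0, 6, 6, 0) := by decide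
example : (slab 14 0 ⟨11, 2, 1⟩, slab 14 1 ⟨11, 2, 1⟩, slab 14 2 ⟨11, 2, 1⟩, slab 14 3 ⟨11, 2, 1⟩) = (0, 4, 6, 2) := by decide
example : (slab 14 0 ⟨11, 1, 2⟩, slab 14 1 ⟨11, 1, 2⟩, slab 14 2 ⟨11, 1, 2⟩, slab 14 3 ⟨11, 1, 2⟩) = (0, 2, 6, 4) := by decide

/-- The BOX slot table at phase `t` (everything doubled to stay in `ℤ[i]`): `1 ↦ 2·hgt`, `h ↦ −2`, `e ↦ −(1+i)·i^t` (weight of `β̄`),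
`ē ↦ −(1−i)·conj(i^t) = −(1−i)·i^{−t}` (weight of `β`), `pt ↦ 0`; its letter functional reads `2·slab_t` (`read_bx`). -/
def bx (hgt : ℤ) (t : Fin 4) : Sym → GaussianInt
  | Sym.one => ((2 * hgt : ℤ) : GaussianInt)
  | Sym.h => ((-2 : ℤ) : GaussianInt)
  | Sym.e => -(opi * ipow t)
  | Sym.ebar => -(omi * star (ipow t))
  | Sym.pt => 0

theorem univ_sym : (Finset.univ : Finset Sym) = {Sym.one, Sym.h, Sym.e, Sym.ebar, Sym.pt} := by decide

theorem sum_sym (φ : Sym → GaussianInt) :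
    ∑ s : Sym, φ s = φ Sym.one + φ Sym.h + φ Sym.e + φ Sym.ebar + φ Sym.pt := by
  rw [univ_sym, Finset.sum_insert (by decide), Finset.sum_insert (by decide), Finset.sum_insert (by decide),
    Finset.sum_insert (by decide), Finset.sum_singleton]
  ring

/-- The letter functional of `bx hgt t` reads `2·slab_t(ℓ)` (every integer letter, no alphabet hypothesis). -/
theorem read_bx (hgt : ℤ) (t : Fin 4) (ℓ : Letter) :
    ∑ s : Sym, bx hgt t s * s.coef ℓ = ((2 * slab hgt t ℓ : ℤ) : GaussianInt) := by
  rw [sum_sym]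
  fin_cases t <;>
  · ext
    · simp [bx, opi, omi, ipow, slab, spro, Sym.coef, Letter.beta, Zsqrtd.re_mul, Zsqrtd.im_mul, Zsqrtd.star_mk,
        Zsqrtd.re_add, Zsqrtd.re_neg, Zsqrtd.re_sub, Zsqrtd.re_intCast, Zsqrtd.im_intCast,]
      try ring
    · simp [bx, opi, omi, ipow, slab, spro, Sym.coef, Letter.beta, Zsqrtd.re_mul, Zsqrtd.im_mul, Zsqrtd.star_mk,
        Zsqrtd.im_add, Zsqrtd.im_neg, Zsqrtd.im_sub, Zsqrtd.re_intCast, Zsqrtd.im_intCast,]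
      try ring

/-- The e-free truncation of the box table reads `2·(hgt − a)` (the slot functional `2·C`, `C = hgt·1 − h`). -/
theorem read_bx0 (hgt : ℤ) (t : Fin 4) (ℓ : Letter) :
    ∑ s : Sym, (if s.efree = true then bx hgt t s else 0) * s.coef ℓ = ((2 * (hgt - ℓ.a) : ℤ) : GaussianInt) := by
  rw [sum_sym]
  simp [bx, Sym.efree, Sym.coef]
  ring

/-- The box table of a phase vector `x : Fin 4 → Fin 4`. -/
def Btab (hgt : ℤ) (x : Fin 4 → Fin 4) : Tab := fun f => bx hgt (x f)

/-- `|x| := x₀ + x₁ + x₂ + x₃ (mod 4)`. -/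
def wt (x : Fin 4 → Fin 4) : Fin 4 := x 0 + x 1 + x 2 + x 3

theorem lamW_Btab_eeee (hgt : ℤ) (x : Fin 4 → Fin 4) :
    lamW (Btab hgt x) Word.eeee = ((-4 : ℤ) : GaussianInt) * ipow (wt x) := by
  simp only [lamW, Btab, Word.eeee, bx, Fin.prod_univ_four, wt]
  rw [show -(opi * ipow (x 0)) * -(opi * ipow (x 1)) * -(opi * ipow (x 2)) * -(opi * ipow (x 3))
      = (opi * opi * opi * opi) * (ipow (x 0) * ipow (x 1) * ipow (x 2) * ipow (x 3)) by ring,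
    opi_pow4, ipow_mul, ipow_mul, ipow_mul]
  push_cast
  ring

theorem lamW_Btab_EEEE (hgt : ℤ) (x : Fin 4 → Fin 4) :
    lamW (Btab hgt x) Word.EEEE = ((-4 : ℤ) : GaussianInt) * ipow (-wt x) := by
  simp only [lamW, Btab, Word.EEEE, bx, Fin.prod_univ_four, wt, star_ipow]
  rw [show -(omi * ipow (-x 0)) * -(omi * ipow (-x 1)) * -(omi * ipow (-x 2)) * -(omi * ipow (-x 3))
      = (omi * omi * omi * omi) * (ipow (-x 0) * ipow (-x 1) * ipow (-x 2) * ipow (-x 3)) by ring,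
    omi_pow4, ipow_mul, ipow_mul, ipow_mul,
    show -x 0 + -x 1 + -x 2 + -x 3 = -(x 0 + x 1 + x 2 + x 3) by abel]
  push_cast
  ring

/-! ## §5 The cell side: `∏_f G_f = 16·ψ_x` and `16·ρ` -/

/-- The BOX weight `ψ_x(c) = ∏_f slab_(x_f)(c_f)` of a cell (an integer, `≥ 0` on the alphabet, `= 0` iff some factor is killed). -/
def psi (hgt : ℤ) (x : Fin 4 → Fin 4) (c : Cell) : ℤ := ∏ f : Fin 4, slab hgt (x f) (c f)

/-- The C-weight `ρ(c) = ∏_f (hgt − a_f)` of a cell (`C = hgt·1 − h` on every factor). -/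
def rho (hgt : ℤ) (c : Cell) : ℤ := ∏ f : Fin 4, (hgt - (c f).a)

/-- `Ψ_x(D) = Σ_N m·ψ_x − Σ_P m·ψ_x`. -/
def Psi (hgt : ℤ) (x : Fin 4 → Fin 4) (D : Design) : ℤ := linZ D.N (psi hgt x) - linZ D.P (psi hgt x)

/-- `Σ(D) = Σ_N m·ρ − Σ_P m·ρ = T(C⊗⁴)` — the C-weighted signed mass (`σ` of the memos). -/
def Sigma (hgt : ℤ) (D : Design) : ℤ := linZ D.N (rho hgt) - linZ D.P (rho hgt)

theorem G_Btab (hgt : ℤ) (x : Fin 4 → Fin 4) (f : Fin 4) (ℓ : Letter) :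
    G (Btab hgt x) f ℓ = ((2 * slab hgt (x f) ℓ : ℤ) : GaussianInt) := by
  unfold G Btab
  exact read_bx hgt (x f) ℓ

theorem G_trunc_Btab (hgt : ℤ) (x : Fin 4 → Fin 4) (f : Fin 4) (ℓ : Letter) :
    G (trunc (Btab hgt x)) f ℓ = ((2 * (hgt - ℓ.a) : ℤ) : GaussianInt) := by
  unfold G trunc Btab
  exact read_bx0 hgt (x f) ℓ

theorem prod_G_Btab (hgt : ℤ) (x : Fin 4 → Fin 4) (c : Cell) :
    ∏ f : Fin 4, G (Btab hgt x) f (c f) = ((16 * psi hgt x c : ℤ) : GaussianInt) := by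
  simp only [G_Btab, psi, Fin.prod_univ_four]
  push_cast
  ring

theorem prod_G_trunc_Btab (hgt : ℤ) (x : Fin 4 → Fin 4) (c : Cell) :
    ∏ f : Fin 4, G (trunc (Btab hgt x)) f (c f) = ((16 * rho hgt c : ℤ) : GaussianInt) := by
  simp only [G_trunc_Btab, rho, Fin.prod_univ_four]
  push_cast
  ring

theorem wsum_eq_cast_linZ (Lst : List (Cell × ℕ)) (φ : Cell → ℤ) :
    wsum Lst (fun c => ((φ c : ℤ) : GaussianInt)) = ((linZ Lst φ : ℤ) : GaussianInt) := by
  induction Lst with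
  | nil => simp [wsum, linZ]
  | cons hd tl ih =>
    simp only [wsum, linZ, List.map_cons, List.sum_cons] at ih ⊢
    rw [ih, Int.cast_add, Int.cast_mul, Int.cast_natCast]

theorem linZ_const_mul (Lst : List (Cell × ℕ)) (k : ℤ) (φ : Cell → ℤ) :
    linZ Lst (fun c => k * φ c) = k * linZ Lst φ := by
  induction Lst with
  | nil => simp [linZ]
  | cons hd tl ih =>
    simp only [linZ, List.map_cons, List.sum_cons] at ih ⊢
    rw [ih]
    ring

theorem wsum_prod_G_Btab (hgt : ℤ) (x : Fin 4 → Fin 4) (Lst : List (Cell × ℕ)) :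
    wsum Lst (fun c => ∏ f : Fin 4, G (Btab hgt x) f (c f)) = ((16 * linZ Lst (psi hgt x) : ℤ) : GaussianInt) := by
  have h1 : wsum Lst (fun c => ∏ f : Fin 4, G (Btab hgt x) f (c f))
      = wsum Lst (fun c => ((16 * psi hgt x c : ℤ) : GaussianInt)) := by
    unfold wsum
    congr 1
    refine List.map_congr_left fun cm _ => ?_
    simp only [prod_G_Btab]
  rw [h1, wsum_eq_cast_linZ, linZ_const_mul]

theorem wsum_prod_G_trunc_Btab (hgt : ℤ) (x : Fin 4 → Fin 4) (Lst : List (Cell × ℕ)) :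
    wsum Lst (fun c => ∏ f : Fin 4, G (trunc (Btab hgt x)) f (c f)) = ((16 * linZ Lst (rho hgt) : ℤ) : GaussianInt) := by
  have h1 : wsum Lst (fun c => ∏ f : Fin 4, G (trunc (Btab hgt x)) f (c f))
      = wsum Lst (fun c => ((16 * rho hgt c : ℤ) : GaussianInt)) := by
    unfold wsum
    congr 1
    refine List.map_congr_left fun cm _ => ?_
    simp only [prod_G_trunc_Btab]
  rw [h1, wsum_eq_cast_linZ, linZ_const_mul]

/-! ## §6 THE BOX IDENTITY -/

/-- The conjugate word is the conjugate charge (as in `XYMomentLaw`): `T(ēēēē) = conj μ`. -/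
theorem cellCoef_EEEE_eq_star (c : Cell) : cellCoef c Word.EEEE = star (cellCoef c Word.eeee) := by
  unfold cellCoef Word.eeee Word.EEEE
  rw [star_prod]
  refine Finset.prod_congr rfl fun f _ => ?_
  simp [Sym.coef]

theorem listsum_star (Lst : List (Cell × ℕ)) :
    (Lst.map fun cm => (cm.2 : GaussianInt) * cellCoef cm.1 Word.EEEE).sum
      = star ((Lst.map fun cm => (cm.2 : GaussianInt) * cellCoef cm.1 Word.eeee).sum) := by
  induction Lst with
  | nil => simp
  | cons hd tl ih =>
    rw [List.map_cons, List.map_cons, List.sum_cons, List.sum_cons, star_add, ih, cellCoef_EEEE_eq_star, star_mul',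
      star_natCast]

theorem T_EEEE_eq_star (D : Design) : D.T Word.EEEE = star D.mu := by
  unfold Design.mu Design.T
  rw [listsum_star, listsum_star, star_sub]

/-- `16·Σ(D) = Σ_w λ⁰_w·T(w)` — `Σ = T(C⊗⁴)` expanded over the e-free words (holds for every design, no (A1) needed). -/
theorem sixteen_sigma_eq (hgt : ℤ) (x : Fin 4 → Fin 4) (D : Design) :
    ((16 * Sigma hgt D : ℤ) : GaussianInt) = ∑ w : Word, lamW (trunc (Btab hgt x)) w * D.T w := by
  rw [expand, wsum_prod_G_trunc_Btab, wsum_prod_G_trunc_Btab]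
  unfold Sigma
  push_cast
  ring

/-- **Gaussian form.** `16·(Ψ_x − Σ) = −4·(i^{|x|}μ + conj(i^{|x|}μ))` under clause 1. -/
theorem sixteen_box_eq (hgt : ℤ) (D : Design) (hA : A1e D) (x : Fin 4 → Fin 4) :
    ((16 * Psi hgt x D : ℤ) : GaussianInt) - ((16 * Sigma hgt D : ℤ) : GaussianInt)
      = ((-4 : ℤ) : GaussianInt) * (ipow (wt x) * D.mu + star (ipow (wt x) * D.mu)) := by
  have h := split (Btab hgt x) D hA
  rw [expand (Btab hgt x) D, expand (trunc (Btab hgt x)) D, lamW_Btab_eeee, lamW_Btab_EEEE, wsum_prod_G_Btab,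
    wsum_prod_G_Btab, wsum_prod_G_trunc_Btab, wsum_prod_G_trunc_Btab, T_EEEE_eq_star] at h
  have hs : star (ipow (wt x) * D.mu) = ipow (-wt x) * star D.mu := by
    rw [star_mul', star_ipow]
  unfold Psi Sigma Design.mu at *
  rw [hs]
  push_cast at h ⊢
  linear_combination h

theorem re_intCast_mul (n : ℤ) (z : GaussianInt) : ((n : GaussianInt) * z).re = n * z.re := by
  simp [Zsqrtd.re_mul]

/-- **THE BOX IDENTITY (real form, every height, every ring; clause 1 of (A1) only).**
`2·Ψ_x(D) = 2·Σ(D) − Re(i^{|x|}·μ)`, i.e. `Σ_c (m_N − m_P)·ψ_x(c) = σ + 2·Re(B̄_x·μ)` with `B_x = −¼·i^{−|x|}`. -/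
theorem box_identity (hgt : ℤ) (D : Design) (hA : A1e D) (x : Fin 4 → Fin 4) :
    2 * Psi hgt x D = 2 * Sigma hgt D - (ipow (wt x) * D.mu).re := by
  have h := sixteen_box_eq hgt D hA x
  have hre := congrArg Zsqrtd.re h
  simp only [Zsqrtd.re_sub, Zsqrtd.re_intCast, re_intCast_mul, Zsqrtd.re_add, Zsqrtd.re_star] at hre
  omega

/-- The same from the tree's full (A1). -/
theorem box_identity_of_A1 (hgt : ℤ) (D : Design) (hA : D.A1) (x : Fin 4 → Fin 4) :
    2 * Psi hgt x D = 2 * Sigma hgt D - (ipow (wt x) * D.mu).re :=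
  box_identity hgt D (a1e_of_a1 D hA) x

/-- The four readings of the charge term: `Re(i^k μ) = Re μ ∕ −Im μ ∕ −Re μ ∕ Im μ` for `k = 0 ∕ 1 ∕ 2 ∕ 3`. -/
theorem ipow_mu_re (D : Design) :
    (ipow 0 * D.mu).re = D.mu.re ∧ (ipow 1 * D.mu).re = -D.mu.im ∧
    (ipow 2 * D.mu).re = -D.mu.re ∧ (ipow 3 * D.mu).re = D.mu.im := by
  refine ⟨?_, ?_, ?_, ?_⟩
  · simp [ipow]
  · simp [ipow, Zsqrtd.re_mul]
  · simp [ipow]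
  · simp [ipow, Zsqrtd.re_mul]

/-! ## §7 Positivity on the alphabet -/

theorem psi_nonneg (hgt : ℤ) (x : Fin 4 → Fin 4) (c : Cell) (hc : ∀ f : Fin 4, (c f).OnAlphabet hgt) : 0 ≤ psi hgt x c :=
  Finset.prod_nonneg fun f _ => slab_nonneg hgt (x f) (c f) (hc f)

/-- On the height-`hgt` alphabet the P-side box mass is `≥ 0` (and so is the N-side one). -/
theorem linZP_psi_nonneg (hgt : ℤ) (D : Design) (hO : D.OnAlphabet hgt) (x : Fin 4 → Fin 4) : 0 ≤ linZ D.P (psi hgt x) := by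
  refine linZ_nonneg _ _ fun cm hcm hpos => psi_nonneg hgt x cm.1 fun f => hO cm.1 ?_ f
  obtain ⟨c, m⟩ := cm
  exact List.mem_append.2 (Or.inr ((mem_suppP_iff D c).2 ⟨m, hcm, hpos⟩))

theorem linZN_psi_nonneg (hgt : ℤ) (D : Design) (hO : D.OnAlphabet hgt) (x : Fin 4 → Fin 4) : 0 ≤ linZ D.N (psi hgt x) := by
  refine linZ_nonneg _ _ fun cm hcm hpos => psi_nonneg hgt x cm.1 fun f => hO cm.1 ?_ f
  obtain ⟨c, m⟩ := cm
  exact List.mem_append.2 (Or.inl ((mem_suppN_iff D c).2 ⟨m, hcm, hpos⟩))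

/-! ## §8 BRANCH B of the dichotomy and the charge bound on `σ` -/

/-- BRANCH B at dropped slot `d` with 3-box `(x_f)_(f ≠ d)`: the N side carries NO box mass for all four phases at slot `d`. -/
def KilledN (hgt : ℤ) (D : Design) (d : Fin 4) (x : Fin 4 → Fin 4) : Prop :=
  ∀ t : Fin 4, linZ D.N (psi hgt (Function.update x d t)) = 0

theorem linZ_eq_zero_of_supp (L : List (Cell × ℕ)) (φ : Cell → ℤ) (h : ∀ cm ∈ L, 0 < cm.2 → φ cm.1 = 0) : linZ L φ = 0 := by
  induction L with
  | nil => simp [linZ]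
  | cons a t ih =>
    rw [linZ_cons]
    have ht : linZ t φ = 0 := ih fun cm hcm => h cm (List.mem_cons_of_mem _ hcm)
    rcases Nat.eq_zero_or_pos a.2 with h0 | hpos
    · rw [h0, ht]; simp
    · rw [h a List.mem_cons_self hpos, ht]; simp

/-- The memo's wording of BRANCH B implies `KilledN`: every N-support cell has a KEPT slot `f ≠ d` whose letter is killed by the box
(`slab_(x_f) = 0`, i.e. `β_f ∈ i^{x_f}·Q`), or all four slabs vanish at the dropped slot (a hub there). -/
theorem killedN_of_threeBox (hgt : ℤ) (D : Design) (d : Fin 4) (x : Fin 4 → Fin 4)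
    (h3 : ∀ c ∈ D.suppN, (∃ f : Fin 4, f ≠ d ∧ slab hgt (x f) (c f) = 0) ∨ (∀ t : Fin 4, slab hgt t (c d) = 0)) :
    KilledN hgt D d x := by
  intro t
  refine linZ_eq_zero_of_supp _ _ fun cm hcm hpos => ?_
  obtain ⟨c, m⟩ := cm
  have hc : c ∈ D.suppN := (mem_suppN_iff D c).2 ⟨m, hcm, hpos⟩
  rcases h3 c hc with ⟨f, hfd, hf⟩ | hd
  · apply Finset.prod_eq_zero (Finset.mem_univ f)
    rw [Function.update_of_ne hfd]
    exact hf
  · apply Finset.prod_eq_zero (Finset.mem_univ d)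
    rw [Function.update_self]
    exact hd t

theorem wt_update (x : Fin 4 → Fin 4) (d t : Fin 4) :
    wt (Function.update x d t) = wt (Function.update x d 0) + t := by
  fin_cases d <;> simp [wt] <;> abel

/-- **BRANCH-B CHARGE BOUND (every height, every ring).** If the N side is killed by a 3-box for all four phases at the dropped slot, then
`2σ + |Re μ| ≤ 0` and `2σ + |Im μ| ≤ 0` — i.e. `σ ≤ −max(|Re μ|, |Im μ|)∕2 (≤ −|μ|∕(2√2))`. Inputs: `box_identity` (clause 1) and the slab lemma
on the P side (alphabet). -/
theorem branchB_bound (hgt : ℤ) (D : Design) (hO : D.OnAlphabet hgt) (hA : A1e D) {d : Fin 4} {x : Fin 4 → Fin 4}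
    (hK : KilledN hgt D d x) : 2 * Sigma hgt D + |D.mu.re| ≤ 0 ∧ 2 * Sigma hgt D + |D.mu.im| ≤ 0 := by
  have key : ∀ t : Fin 4, 2 * Sigma hgt D ≤ (ipow (wt (Function.update x d t)) * D.mu).re := by
    intro t
    have hb := box_identity hgt D hA (Function.update x d t)
    have hN := hK t
    have hP := linZP_psi_nonneg hgt D hO (Function.update x d t)
    unfold Psi at hb
    omega
  have hk : ∀ k : Fin 4, 2 * Sigma hgt D ≤ (ipow k * D.mu).re := by
    intro k
    have h := key (k - wt (Function.update x d 0))
    rwa [wt_update, show wt (Function.update x d 0) + (k - wt (Function.update x d 0)) = k by abel] at h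
  obtain ⟨h0, h1, h2, h3⟩ := ipow_mu_re D
  have k0 := hk 0
  have k1 := hk 1
  have k2 := hk 2
  have k3 := hk 3
  rw [h0] at k0
  rw [h1] at k1
  rw [h2] at k2
  rw [h3] at k3
  rcases abs_cases D.mu.re with ⟨hr, _⟩ | ⟨hr, _⟩ <;> rcases abs_cases D.mu.im with ⟨hi, _⟩ | ⟨hi, _⟩ <;>
    constructor <;> omega

/-- In BRANCH B a charged design has `σ < 0`. -/
theorem sigma_neg_of_killedN (hgt : ℤ) (D : Design) (hO : D.OnAlphabet hgt) (hA : A1e D) (hμ : D.mu ≠ 0) {d : Fin 4}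
    {x : Fin 4 → Fin 4} (hK : KilledN hgt D d x) : Sigma hgt D < 0 := by
  obtain ⟨hre, him⟩ := branchB_bound hgt D hO hA hK
  by_contra hσ
  push Not at hσ
  have h1 : D.mu.re = 0 := by
    rcases abs_cases D.mu.re with ⟨h, _⟩ | ⟨h, _⟩ <;> omega
  have h2 : D.mu.im = 0 := by
    rcases abs_cases D.mu.im with ⟨h, _⟩ | ⟨h, _⟩ <;> omega
  exact hμ (Zsqrtd.ext h1 h2)

/-- **THE DICHOTOMY'S USE.** `σ ≥ 0` and `μ ≠ 0` force BRANCH A: no 3-box kills the N side at any dropped slot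
(at shell 2 under dual g15's `door_law`, `σ = −4k = 0`; memo §2 (2a)). -/
theorem not_killedN_of_sigma_nonneg (hgt : ℤ) (D : Design) (hO : D.OnAlphabet hgt) (hA : A1e D) (hμ : D.mu ≠ 0)
    (hσ : 0 ≤ Sigma hgt D) (d : Fin 4) (x : Fin 4 → Fin 4) : ¬ KilledN hgt D d x :=
  fun hK => absurd (sigma_neg_of_killedN hgt D hO hA hμ hK) (not_lt.2 hσ)

/-- BRANCH B also bounds the P-side box mass from below: `2·Σ_P m·ψ_(x[d ↦ t]) ≥ Re(i^{|x[d ↦ t]|}·μ) − 2σ` for each phase — the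
«P carries an off-axis pair ∕ box mass at every phase» face (memo §5 (5a)); with `KilledN` the left side is all of `−2Ψ`. -/
theorem linZP_psi_lower_of_killedN (hgt : ℤ) (D : Design) (hA : A1e D) {d : Fin 4} {x : Fin 4 → Fin 4}
    (hK : KilledN hgt D d x) (t : Fin 4) :
    2 * linZ D.P (psi hgt (Function.update x d t)) = (ipow (wt (Function.update x d t)) * D.mu).re - 2 * Sigma hgt D := by
  have hb := box_identity hgt D hA (Function.update x d t)
  have hN := hK t
  unfold Psi at hb
  omega

/-! ## §9 THE `16·(1+i)` LATTICE OF `μ` AND `σ (mod 16)` (every height; clause 1 + alphabet)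

On the alphabet every slab is EVEN (`slab_t = |x| + |y| − s_t` and `s_t ≡ x + y (mod 2)`), so `16 ∣ ψ_x(c)` for every supported cell
and `16 ∣ Ψ_x(D)`; the four instances `x = (k, 0, 0, 0)` of `box_identity` then give `16 ∣ Re μ`, `16 ∣ Im μ`, `32 ∣ Re μ + Im μ`
(i.e. `μ ∈ 16·(1+i)·ℤ[i]`) and `32 ∣ 2σ − Re μ` (`σ ≡ Re μ ∕ 2 (mod 16)`, in particular `8 ∣ σ`). This is anomaly g16's CANDIDATE lattice
of bus l.13436 (S3-5) («μ ∈ 16(1+i)ℤ[i] and σ₃ ≡ Re μ∕2 mod 16», fitted on the EFA designs), now a theorem for every integer design with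
CLAUSE 1 of (A1) on the height-`hgt` alphabet, at every ring and without any budget, rule-D or door hypothesis; it sharpens s4 g36's
`XYMomentLaw.eight_dvd_charge` (`8 ∣ μ`, clause 1 alone) by the alphabet's taxicab parity. (Shell 2 under dual g15's door has the
stronger `32 ∣ Re μ, Im μ` — `RingTwoMassLaw.door_law`.) -/

theorem slab_even (hgt : ℤ) (t : Fin 4) (ℓ : Letter) (hℓ : ℓ.OnAlphabet hgt) : 2 ∣ slab hgt t ℓ := by
  obtain ⟨hh, -⟩ := hℓ
  unfold Letter.height at hh
  rcases abs_choice ℓ.x with hx | hx <;> rcases abs_choice ℓ.y with hy | hy <;>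
    fin_cases t <;> simp only [slab, spro] <;> omega

theorem psi_dvd_sixteen (hgt : ℤ) (x : Fin 4 → Fin 4) (c : Cell) (hc : ∀ f : Fin 4, (c f).OnAlphabet hgt) :
    16 ∣ psi hgt x c := by
  obtain ⟨k0, h0⟩ := slab_even hgt (x 0) (c 0) (hc 0)
  obtain ⟨k1, h1⟩ := slab_even hgt (x 1) (c 1) (hc 1)
  obtain ⟨k2, h2⟩ := slab_even hgt (x 2) (c 2) (hc 2)
  obtain ⟨k3, h3⟩ := slab_even hgt (x 3) (c 3) (hc 3)
  refine ⟨k0 * k1 * k2 * k3, ?_⟩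
  rw [psi, Fin.prod_univ_four, h0, h1, h2, h3]
  ring

theorem linZ_dvd_of_supp (L : List (Cell × ℕ)) (φ : Cell → ℤ) (n : ℤ) (h : ∀ cm ∈ L, 0 < cm.2 → n ∣ φ cm.1) :
    n ∣ linZ L φ := by
  induction L with
  | nil => simp [linZ]
  | cons a t ih =>
    rw [linZ_cons]
    have ht : n ∣ linZ t φ := ih fun cm hcm => h cm (List.mem_cons_of_mem _ hcm)
    rcases Nat.eq_zero_or_pos a.2 with h0 | hpos
    · rw [h0]
      simpa using ht
    · exact dvd_add (dvd_mul_of_dvd_right (h a List.mem_cons_self hpos) _) ht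

theorem Psi_dvd_sixteen (hgt : ℤ) (D : Design) (hO : D.OnAlphabet hgt) (x : Fin 4 → Fin 4) : 16 ∣ Psi hgt x D := by
  unfold Psi
  refine dvd_sub ?_ ?_
  · refine linZ_dvd_of_supp _ _ _ fun cm hcm hpos => psi_dvd_sixteen hgt x cm.1 fun f => hO cm.1 ?_ f
    obtain ⟨c, m⟩ := cm
    exact List.mem_append.2 (Or.inl ((mem_suppN_iff D c).2 ⟨m, hcm, hpos⟩))
  · refine linZ_dvd_of_supp _ _ _ fun cm hcm hpos => psi_dvd_sixteen hgt x cm.1 fun f => hO cm.1 ?_ f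
    obtain ⟨c, m⟩ := cm
    exact List.mem_append.2 (Or.inr ((mem_suppP_iff D c).2 ⟨m, hcm, hpos⟩))

/-- The pure phase vector `(k, 0, 0, 0)` has `|x| = k`. -/
theorem wt_single (k : Fin 4) : wt ![k, 0, 0, 0] = k := by
  simp [wt]

/-- **LATTICE LAW (every height, every ring; clause 1 + alphabet).** `16 ∣ Re μ`, `16 ∣ Im μ`, `32 ∣ Re μ + Im μ` (`μ ∈ 16(1+i)ℤ[i]`)
and `32 ∣ 2σ − Re μ` (`σ ≡ Re μ∕2 (mod 16)`, so `8 ∣ σ`). -/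
theorem lattice_sixteen (hgt : ℤ) (D : Design) (hO : D.OnAlphabet hgt) (hA : A1e D) :
    16 ∣ D.mu.re ∧ 16 ∣ D.mu.im ∧ 32 ∣ D.mu.re + D.mu.im ∧ 32 ∣ 2 * Sigma hgt D - D.mu.re := by
  obtain ⟨h0, h1, h2, h3⟩ := ipow_mu_re D
  have b0 := box_identity hgt D hA ![0, 0, 0, 0]
  have b1 := box_identity hgt D hA ![1, 0, 0, 0]
  have b2 := box_identity hgt D hA ![2, 0, 0, 0]
  have b3 := box_identity hgt D hA ![3, 0, 0, 0]
  rw [wt_single, h0] at b0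
  rw [wt_single, h1] at b1
  rw [wt_single, h2] at b2
  rw [wt_single, h3] at b3
  have d0 := Psi_dvd_sixteen hgt D hO ![0, 0, 0, 0]
  have d1 := Psi_dvd_sixteen hgt D hO ![1, 0, 0, 0]
  have d2 := Psi_dvd_sixteen hgt D hO ![2, 0, 0, 0]
  have d3 := Psi_dvd_sixteen hgt D hO ![3, 0, 0, 0]
  refine ⟨?_, ?_, ?_, ?_⟩ <;> omega

/-- `8 ∣ σ` on every charged or uncharged design with clause 1 on the alphabet. -/
theorem eight_dvd_sigma (hgt : ℤ) (D : Design) (hO : D.OnAlphabet hgt) (hA : A1e D) : 8 ∣ Sigma hgt D := by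
  obtain ⟨l0, -, -, l3⟩ := lattice_sixteen hgt D hO hA
  omega

/-- A charged design has `max(|Re μ|, |Im μ|) ≥ 16`; hence BRANCH B (`KilledN`) costs `σ ≤ −8`. -/
theorem sigma_le_neg_eight_of_killedN (hgt : ℤ) (D : Design) (hO : D.OnAlphabet hgt) (hA : A1e D) (hμ : D.mu ≠ 0)
    {d : Fin 4} {x : Fin 4 → Fin 4} (hK : KilledN hgt D d x) : Sigma hgt D ≤ -8 := by
  obtain ⟨hre, him⟩ := branchB_bound hgt D hO hA hK
  obtain ⟨l0, l1, -, -⟩ := lattice_sixteen hgt D hO hA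
  by_contra hσ
  push Not at hσ
  have h1 : D.mu.re = 0 := by
    rcases abs_cases D.mu.re with ⟨h, _⟩ | ⟨h, _⟩ <;> omega
  have h2 : D.mu.im = 0 := by
    rcases abs_cases D.mu.im with ⟨h, _⟩ | ⟨h, _⟩ <;> omega
  exact hμ (Zsqrtd.ext h1 h2)

/-! ## §10 THE COVERING DICHOTOMY (every height; clause 1 + alphabet)

Fix a phase class `k` with `−Re(i^k μ) ≥ 16` (one exists for `μ ≠ 0` by §9). EITHER `2σ − Re(i^k μ) > 0`, and then EVERY box `x`
with `|x| = k` has `Ψ_x ≥ 16`, i.e. `Σ_N m·ψ_x ≥ 16 + Σ_P m·ψ_x` on all 64 boxes of the class — BRANCH A′: the N support MEETS every box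
of class `k` (some N-support cell has all four slabs positive there; H-bearing cells never do); OR `2σ ≤ Re(i^k μ) ≤ −16`, and then every
box of the opposite class `k + 2` has `Ψ_x ≤ −16`, i.e. `Σ_P m·ψ_x ≥ 16 + Σ_N m·ψ_x` — BRANCH B′: the P support meets every box of class
`k + 2`, and `σ ≤ −8` (so clause 2's pair face `σ = 4(k^N − k^P)(gh)` gives `k^P(gh) ≥ 2 + k^N(gh)` at all six slot pairs, memo §5).
BRANCH B of §8 (`KilledN`) implies B′ (`branchB_bound`); A′ and B′ are exhaustive. The DISTINCT-CELL counts this forces on the two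
ring-3 rooms are in the memo (HOME `line-22/ring3/class_cover.py`: a cell meets at most 6 (`u⁴`, `Auuu`), 7 (`Buuu`), 10 (`BBuu`),
21 (`BBBB`) boxes of one class; fine room: A′ needs ≥ 10 distinct H-free N cells, B′ ≥ 7 distinct H-free P cells; coarse: ≥ 7 ∕ ≥ 4). -/

theorem ipow_add_two (k : Fin 4) : ipow (k + 2) = -ipow k := by
  fin_cases k <;> decide

/-- For a charged design some phase class has charge term `−Re(i^k μ) ≥ 16`. -/
theorem exists_good_class (hgt : ℤ) (D : Design) (hO : D.OnAlphabet hgt) (hA : A1e D) (hμ : D.mu ≠ 0) :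
    ∃ k : Fin 4, 16 ≤ -(ipow k * D.mu).re := by
  obtain ⟨h0, h1, h2, h3⟩ := ipow_mu_re D
  obtain ⟨l0, l1, -, -⟩ := lattice_sixteen hgt D hO hA
  by_cases hre : D.mu.re = 0
  · have him : D.mu.im ≠ 0 := fun him => hμ (Zsqrtd.ext hre him)
    rcases lt_or_gt_of_ne him with hlt | hlt
    · exact ⟨3, by rw [h3]; omega⟩
    · exact ⟨1, by rw [h1]; omega⟩
  · rcases lt_or_gt_of_ne hre with hlt | hlt
    · exact ⟨0, by rw [h0]; omega⟩
    · exact ⟨2, by rw [h2]; omega⟩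

/-- BRANCH A′: `Ψ_x ≥ 16` on every box of the class. -/
theorem classA_content (hgt : ℤ) (D : Design) (hO : D.OnAlphabet hgt) (hA : A1e D) (k : Fin 4)
    (hpos : 0 < 2 * Sigma hgt D - (ipow k * D.mu).re) (x : Fin 4 → Fin 4) (hx : wt x = k) : 16 ≤ Psi hgt x D := by
  have hb := box_identity hgt D hA x
  rw [hx] at hb
  have hd := Psi_dvd_sixteen hgt D hO x
  omega

/-- BRANCH A′, mass form: `Σ_N m·ψ_x ≥ 16 + Σ_P m·ψ_x` on every box of the class (the F⁺-SITE LAW of every ring: in units of 16,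
N box weight `≥ 1 +` P box weight). -/
theorem classA_Nmass (hgt : ℤ) (D : Design) (hO : D.OnAlphabet hgt) (hA : A1e D) (k : Fin 4)
    (hpos : 0 < 2 * Sigma hgt D - (ipow k * D.mu).re) (x : Fin 4 → Fin 4) (hx : wt x = k) :
    16 + linZ D.P (psi hgt x) ≤ linZ D.N (psi hgt x) := by
  have h := classA_content hgt D hO hA k hpos x hx
  unfold Psi at h
  omega

/-- BRANCH B′: `Ψ_x ≤ −16` on every box of the opposite class. -/
theorem classB_content (hgt : ℤ) (D : Design) (hO : D.OnAlphabet hgt) (hA : A1e D) (k : Fin 4)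
    (hk : 16 ≤ -(ipow k * D.mu).re) (hnonpos : 2 * Sigma hgt D - (ipow k * D.mu).re ≤ 0) (x : Fin 4 → Fin 4)
    (hx : wt x = k + 2) : Psi hgt x D ≤ -16 := by
  have hb := box_identity hgt D hA x
  rw [hx, ipow_add_two, neg_mul, Zsqrtd.re_neg] at hb
  have hd := Psi_dvd_sixteen hgt D hO x
  omega

/-- BRANCH B′, mass form: `Σ_P m·ψ_x ≥ 16 + Σ_N m·ψ_x` on every box of the opposite class. -/
theorem classB_Pmass (hgt : ℤ) (D : Design) (hO : D.OnAlphabet hgt) (hA : A1e D) (k : Fin 4)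
    (hk : 16 ≤ -(ipow k * D.mu).re) (hnonpos : 2 * Sigma hgt D - (ipow k * D.mu).re ≤ 0) (x : Fin 4 → Fin 4)
    (hx : wt x = k + 2) : 16 + linZ D.N (psi hgt x) ≤ linZ D.P (psi hgt x) := by
  have h := classB_content hgt D hO hA k hk hnonpos x hx
  unfold Psi at h
  omega

/-- A positive integer mass has an ALIVE supported cell. -/
theorem exists_alive_of_linZ_pos (L : List (Cell × ℕ)) (φ : Cell → ℤ) (h : 0 < linZ L φ) :
    ∃ cm ∈ L, 0 < cm.2 ∧ 0 < φ cm.1 := by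
  induction L with
  | nil => simp [linZ] at h
  | cons a t ih =>
    rw [linZ_cons] at h
    by_cases ha : 0 < a.2 ∧ 0 < φ a.1
    · exact ⟨a, List.mem_cons_self, ha⟩
    · have ht : 0 < linZ t φ := by
        rcases Nat.eq_zero_or_pos a.2 with h0 | hpos
        · rw [h0] at h
          simpa using h
        · have hφ : φ a.1 ≤ 0 := by
            by_contra hφ
            exact ha ⟨hpos, by omega⟩
          have hcast : (0 : ℤ) ≤ (a.2 : ℤ) := by positivity
          nlinarith
      obtain ⟨cm, hcm, hc⟩ := ih ht
      exact ⟨cm, List.mem_cons_of_mem _ hcm, hc⟩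

/-- In BRANCH A′ every box of the class MEETS the N support: some N-support cell has `ψ_x > 0` (all four slabs positive; in particular
the cell is H-free, `slab_hub`). -/
theorem classA_meets (hgt : ℤ) (D : Design) (hO : D.OnAlphabet hgt) (hA : A1e D) (k : Fin 4)
    (hpos : 0 < 2 * Sigma hgt D - (ipow k * D.mu).re) (x : Fin 4 → Fin 4) (hx : wt x = k) :
    ∃ c ∈ D.suppN, 0 < psi hgt x c := by
  have h := classA_Nmass hgt D hO hA k hpos x hx
  have hP := linZP_psi_nonneg hgt D hO x
  obtain ⟨cm, hcm, hm, hc⟩ := exists_alive_of_linZ_pos D.N (psi hgt x) (by omega)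
  exact ⟨cm.1, (mem_suppN_iff D cm.1).2 ⟨cm.2, by simpa using hcm, hm⟩, hc⟩

/-- In BRANCH B′ every box of the opposite class MEETS the P support. -/
theorem classB_meets (hgt : ℤ) (D : Design) (hO : D.OnAlphabet hgt) (hA : A1e D) (k : Fin 4)
    (hk : 16 ≤ -(ipow k * D.mu).re) (hnonpos : 2 * Sigma hgt D - (ipow k * D.mu).re ≤ 0) (x : Fin 4 → Fin 4)
    (hx : wt x = k + 2) : ∃ c ∈ D.suppP, 0 < psi hgt x c := by
  have h := classB_Pmass hgt D hO hA k hk hnonpos x hx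
  have hN := linZN_psi_nonneg hgt D hO x
  obtain ⟨cm, hcm, hm, hc⟩ := exists_alive_of_linZ_pos D.P (psi hgt x) (by omega)
  exact ⟨cm.1, (mem_suppP_iff D cm.1).2 ⟨cm.2, by simpa using hcm, hm⟩, hc⟩

/-- **THE COVERING DICHOTOMY (every height, every ring; clause 1 + alphabet).** For a charged design there is a phase class `k` such
that EITHER the N support meets all 64 boxes of class `k` with box mass `Σ_N m·ψ_x ≥ 16 + Σ_P m·ψ_x` (BRANCH A′), OR `σ ≤ −8` and the
P support meets all 64 boxes of class `k + 2` with `Σ_P m·ψ_x ≥ 16 + Σ_N m·ψ_x` (BRANCH B′). -/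
theorem covering_dichotomy (hgt : ℤ) (D : Design) (hO : D.OnAlphabet hgt) (hA : A1e D) (hμ : D.mu ≠ 0) :
    ∃ k : Fin 4, (∀ x : Fin 4 → Fin 4, wt x = k → 16 + linZ D.P (psi hgt x) ≤ linZ D.N (psi hgt x)) ∨
      (Sigma hgt D ≤ -8 ∧ ∀ x : Fin 4 → Fin 4, wt x = k + 2 → 16 + linZ D.N (psi hgt x) ≤ linZ D.P (psi hgt x)) := by
  obtain ⟨k, hk⟩ := exists_good_class hgt D hO hA hμ
  refine ⟨k, ?_⟩
  by_cases hpos : 0 < 2 * Sigma hgt D - (ipow k * D.mu).re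
  · exact Or.inl fun x hx => classA_Nmass hgt D hO hA k hpos x hx
  · push Not at hpos
    exact Or.inr ⟨by omega, fun x hx => classB_Pmass hgt D hO hA k hk hpos x hx⟩

/-- `σ ≥ −7` (in particular `σ ≥ 0`, e.g. under a door law) puts a charged design in BRANCH A′. -/
theorem classA_of_sigma_gt (hgt : ℤ) (D : Design) (hO : D.OnAlphabet hgt) (hA : A1e D) (hμ : D.mu ≠ 0) (hσ : -8 < Sigma hgt D) :
    ∃ k : Fin 4, ∀ x : Fin 4 → Fin 4, wt x = k → 16 + linZ D.P (psi hgt x) ≤ linZ D.N (psi hgt x) := by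
  obtain ⟨k, h | ⟨hσ', -⟩⟩ := covering_dichotomy hgt D hO hA hμ
  · exact ⟨k, h⟩
  · omega

/-! ## §11 THE SUPPLIER SHADOW LAW and FOUR-PER-BOX (negation g22; memo `FOURFOLD-negation-g22.md` §1–§2) -/

/-- `1, 4, 9, 16` are not sums of two positive squares: a Pythagorean step of length `≤ 4` is AXIS-PARALLEL. -/
theorem axis_of_sq_add_sq (dx dy d : ℤ) (hd0 : 0 < d) (hd : d ≤ 4) (h : dx ^ 2 + dy ^ 2 = d ^ 2) :
    dx = 0 ∨ dy = 0 := by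
  have h1 : -4 ≤ dx := by nlinarith [sq_nonneg dy, sq_nonneg (dx + 4)]
  have h2 : dx ≤ 4 := by nlinarith [sq_nonneg dy, sq_nonneg (dx - 4)]
  have h3 : -4 ≤ dy := by nlinarith [sq_nonneg dx, sq_nonneg (dy + 4)]
  have h4 : dy ≤ 4 := by nlinarith [sq_nonneg dx, sq_nonneg (dy - 4)]
  have hd2 : d ^ 2 = 1 ∨ d ^ 2 = 4 ∨ d ^ 2 = 9 ∨ d ^ 2 = 16 := by
    interval_cases d <;> simp
  rw [← h] at hd2
  interval_cases dx <;> interval_cases dy <;> omega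

/-- `u² = d²` gives `u = d ∨ u = −d`. -/
theorem eq_or_eq_neg_of_sq_eq (u d : ℤ) (h : u ^ 2 = d ^ 2) : u = d ∨ u = -d := by
  have h' : (u - d) * (u + d) = 0 := by ring_nf; linarith [h]
  rcases mul_eq_zero.mp h' with h1 | h1
  · left; omega
  · right; omega

/-- **SHADOW LAW, one factor.** A NULL step of length `a′ − a ≤ 4` does not increase any slab: `slab_t(ℓ′) ≤ slab_t(ℓ)` for all
four phases `t` (the step is axis-parallel, so `s_t` changes by `±(a′ − a)` while `hgt − a` drops by `a′ − a`). -/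
theorem slab_le_of_nullStep (hgt : ℤ) (t : Fin 4) {ℓ ℓ' : Letter} (h : NullStep ℓ ℓ') (hΔ : ℓ'.a - ℓ.a ≤ 4) :
    slab hgt t ℓ' ≤ slab hgt t ℓ := by
  obtain ⟨ha, hsq⟩ := h
  rcases axis_of_sq_add_sq _ _ _ (by omega) hΔ hsq with hx | hy
  · rw [hx] at hsq
    have hy2 : (ℓ'.y - ℓ.y) ^ 2 = (ℓ'.a - ℓ.a) ^ 2 := by linarith [hsq]
    rcases eq_or_eq_neg_of_sq_eq _ _ hy2 with h1 | h1 <;>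
      fin_cases t <;> simp only [slab, spro] <;> omega
  · rw [hy] at hsq
    have hx2 : (ℓ'.x - ℓ.x) ^ 2 = (ℓ'.a - ℓ.a) ^ 2 := by linarith [hsq]
    rcases eq_or_eq_neg_of_sq_eq _ _ hx2 with h1 | h1 <;>
      fin_cases t <;> simp only [slab, spro] <;> omega

/-- Sharpness in the step length: the first non-axis NULL step has length `5`, e.g. `(0; −12, −2) → (5; −8, 1)` at height `14`
(`4² + 3² = 5²`); the law is used only inside shell `4`. -/
example : NullStep ⟨0, -12, -2⟩ ⟨5, -8, 1⟩ := by unfold NullStep; decide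
example : slab 14 0 ⟨0, -12, -2⟩ = 28 ∧ slab 14 0 ⟨5, -8, 1⟩ = 16 := by decide

/-- On the height-`hgt` alphabet a letter has `a ≤ hgt`. -/
theorem a_le_of_onAlphabet (hgt : ℤ) (ℓ : Letter) (hℓ : ℓ.OnAlphabet hgt) : ℓ.a ≤ hgt :=
  LeggedFloor.level_le_of_onAlphabet hℓ

/-- **SHADOW LAW, cells.** If the P-cell `x` SUPPLIES the N-cell `y` at some block (LeggedFloor's `Supplies`: equal off the block,
equal-or-NULL-step on it), both on the height-`hgt` alphabet and `x` within shell `4` (`a_f ≥ hgt − 4`), then `ψ_t(y) ≤ ψ_t(x)` at EVERY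
box `t`: a supplier is alive wherever the cell it supplies is, with at least the same weight. -/
theorem psi_le_of_supplies (hgt : ℤ) {x y : Cell} {g j : Fin 4} (hS : Supplies x y g j)
    (hy : ∀ f : Fin 4, (y f).OnAlphabet hgt)
    (hx4 : ∀ f : Fin 4, hgt - 4 ≤ (x f).a) (t : Fin 4 → Fin 4) : psi hgt t y ≤ psi hgt t x := by
  obtain ⟨hoff, hg, hj⟩ := hS
  unfold psi
  refine Finset.prod_le_prod (fun f _ => slab_nonneg hgt (t f) (y f) (hy f)) fun f _ => ?_
  have step : ∀ f : Fin 4, (x f = y f ∨ NullStep (x f) (y f)) → slab hgt (t f) (y f) ≤ slab hgt (t f) (x f) := by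
    intro f hf
    rcases hf with he | hn
    · rw [he]
    · exact slab_le_of_nullStep hgt (t f) hn (by have := a_le_of_onAlphabet hgt (y f) (hy f); have := hx4 f; omega)
  by_cases hfg : f = g
  · subst hfg; exact step f hg
  by_cases hfj : f = j
  · subst hfj; exact step f hj
  · rw [hoff f hfg hfj]

/-- A cell ALIVE at a box (`ψ_t > 0`) on the alphabet has no letter with `β = 0`, hence DETECTS every block. -/
theorem detects_of_psi_pos (hgt : ℤ) (t : Fin 4 → Fin 4) (c : Cell) (hc : ∀ f : Fin 4, (c f).OnAlphabet hgt)
    (hpos : 0 < psi hgt t c) (g j : Fin 4) : Detects c g j := by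
  unfold Detects
  rintro ⟨hgx, hgy, -, -, -⟩
  have hzero : slab hgt (t g) (c g) = 0 := by
    obtain ⟨hh, -⟩ := hc g
    unfold Letter.height at hh
    rw [hgx, hgy] at hh
    have : spro (t g) (c g) = 0 := by
      generalize t g = s
      fin_cases s <;> simp only [spro] <;> omega
    simp only [slab, this]
    simp at hh
    omega
  have : psi hgt t c = 0 := by
    unfold psi
    exact Finset.prod_eq_zero (Finset.mem_univ g) hzero
  omega

/-- Two cells that agree at every slot are equal. -/
theorem cell_eq_of_forall {x y : Cell} (h : ∀ f : Fin 4, x f = y f) : x = y := funext h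

/-- Under `Disj`, a P-support cell never equals an N-support cell. -/
theorem ne_of_disj (D : Design) (hdis : Disj D) {x y : Cell} (hx : x ∈ D.suppP) (hy : y ∈ D.suppN) : x ≠ y :=
  fun h => hdis y hy (h ▸ hx)

/-- **THREE DISTINCT SUPPLIERS.** Under RULE D (N side) and `Disj`, an N-support cell that detects every block has at least THREE
pairwise distinct P-support cells supplying it (memo §1 (1d): two suppliers cannot serve all six blocks — moved-slot sets `{p}`, `{q}` miss
the complementary block, and a two-slot mover serves one block only). -/
theorem three_suppliers (D : Design) (hR : RuleD D) (hdis : Disj D) (y : Cell) (hy : y ∈ D.suppN)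
    (hdet : ∀ g j : Fin 4, g < j → Detects y g j) :
    ∃ a b c : Cell, a ∈ D.suppP ∧ b ∈ D.suppP ∧ c ∈ D.suppP ∧ a ≠ b ∧ a ≠ c ∧ b ≠ c ∧
      (∃ g j, Supplies a y g j) ∧ (∃ g j, Supplies b y g j) ∧ (∃ g j, Supplies c y g j) := by
  obtain ⟨hN, -⟩ := hR
  have get : ∀ g j : Fin 4, g < j → ∃ x ∈ D.suppP, Supplies x y g j := fun g j hgj => hN y hy g j hgj (hdet g j hgj)
  obtain ⟨x01, m01, s01⟩ := get 0 1 (by decide)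
  obtain ⟨x23, m23, s23⟩ := get 2 3 (by decide)
  obtain ⟨x02, m02, s02⟩ := get 0 2 (by decide)
  obtain ⟨x13, m13, s13⟩ := get 1 3 (by decide)
  obtain ⟨x12, m12, s12⟩ := get 1 2 (by decide)
  obtain ⟨x03, m03, s03⟩ := get 0 3 (by decide)
  have n01 := ne_of_disj D hdis m01 hy
  have n23 := ne_of_disj D hdis m23 hy
  have n02 := ne_of_disj D hdis m02 hy
  have n13 := ne_of_disj D hdis m13 hy
  have n12 := ne_of_disj D hdis m12 hy
  have n03 := ne_of_disj D hdis m03 hy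
  -- agreement off the block
  have a01 : x01 2 = y 2 ∧ x01 3 = y 3 := ⟨s01.1 2 (by decide) (by decide), s01.1 3 (by decide) (by decide)⟩
  have a23 : x23 0 = y 0 ∧ x23 1 = y 1 := ⟨s23.1 0 (by decide) (by decide), s23.1 1 (by decide) (by decide)⟩
  have a02 : x02 1 = y 1 ∧ x02 3 = y 3 := ⟨s02.1 1 (by decide) (by decide), s02.1 3 (by decide) (by decide)⟩
  have a13 : x13 0 = y 0 ∧ x13 2 = y 2 := ⟨s13.1 0 (by decide) (by decide), s13.1 2 (by decide) (by decide)⟩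
  have a12 : x12 0 = y 0 ∧ x12 3 = y 3 := ⟨s12.1 0 (by decide) (by decide), s12.1 3 (by decide) (by decide)⟩
  have a03 : x03 1 = y 1 ∧ x03 2 = y 2 := ⟨s03.1 1 (by decide) (by decide), s03.1 2 (by decide) (by decide)⟩
  have four : ∀ {x : Cell}, x 0 = y 0 → x 1 = y 1 → x 2 = y 2 → x 3 = y 3 → x = y := by
    intro x h0 h1 h2 h3; funext f; fin_cases f <;> assumption
  have d0123 : x01 ≠ x23 := by
    rintro rfl; exact n01 (four a23.1 a23.2 a01.1 a01.2)
  refine ⟨x01, x23, ?_⟩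
  by_cases e1 : x02 = x01
  · -- then x01 moves only slot 0
    subst e1
    by_cases e2 : x13 = x23
    · subst e2
      -- x01 moves only slot 0, x23 (= x13) moves only slot 3; x12 agrees with y at 0 and 3, so differs from both
      refine ⟨x12, m01, m23, m12, d0123, ?_, ?_, ⟨0, 1, s01⟩, ⟨2, 3, s23⟩, ⟨1, 2, s12⟩⟩
      · rintro rfl; exact n02 (four a12.1 a02.1 a01.1 a01.2)
      · rintro rfl; exact n23 (four a23.1 a23.2 a13.2 a12.2)
    · by_cases e3 : x13 = x02
      · subst e3; exact absurd (four a13.1 a02.1 a01.1 a01.2) n02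
      · exact ⟨x13, m01, m23, m13, d0123, fun h => e3 h.symm, fun h => e2 h.symm, ⟨0, 1, s01⟩, ⟨2, 3, s23⟩, ⟨1, 3, s13⟩⟩
  · by_cases e1' : x02 = x23
    · subst e1'
      -- x23 (= x02) moves only slot 2
      by_cases e2 : x13 = x01
      · subst e2
        -- x01 (= x13) moves only slot 1; x03 agrees with y at 1 and 2
        refine ⟨x03, m01, m02, m03, d0123, ?_, ?_, ⟨0, 1, s01⟩, ⟨2, 3, s23⟩, ⟨0, 3, s03⟩⟩
        · rintro rfl; exact n01 (four a13.1 a03.1 a01.1 a01.2)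
        · rintro rfl; exact n02 (four a23.1 a23.2 a03.2 a02.2)
      · by_cases e3 : x13 = x02
        · subst e3; exact absurd (four a13.1 a02.1 a13.2 a02.2) n02
        · exact ⟨x13, m01, m02, m13, d0123, fun h => e2 h.symm, fun h => e3 h.symm, ⟨0, 1, s01⟩, ⟨2, 3, s23⟩, ⟨1, 3, s13⟩⟩
    · exact ⟨x02, m01, m23, m02, d0123, fun h => e1 h.symm, fun h => e1' h.symm, ⟨0, 1, s01⟩, ⟨2, 3, s23⟩, ⟨0, 2, s02⟩⟩


/-- `linZ` is monotone in the weight on positive-mass entries. -/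
theorem linZ_mono (L : List (Cell × ℕ)) (φ χ : Cell → ℤ) (h : ∀ cm ∈ L, 0 < cm.2 → φ cm.1 ≤ χ cm.1) :
    linZ L φ ≤ linZ L χ := by
  induction L with
  | nil => simp [linZ]
  | cons a t ih =>
    rw [linZ_cons, linZ_cons]
    have ht : linZ t φ ≤ linZ t χ := ih fun cm hcm => h cm (List.mem_cons_of_mem _ hcm)
    rcases Nat.eq_zero_or_pos a.2 with h0 | hpos
    · rw [h0, Nat.cast_zero, zero_mul, zero_mul]
      linarith
    · have ha : φ a.1 ≤ χ a.1 := h a List.mem_cons_self hpos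
      have hm : (0 : ℤ) ≤ (a.2 : ℤ) := by exact_mod_cast Nat.zero_le _
      have hprod : (a.2 : ℤ) * φ a.1 ≤ (a.2 : ℤ) * χ a.1 := mul_le_mul_of_nonneg_left ha hm
      linarith

/-- Three pairwise DISTINCT P-support cells contribute at least `φ a + φ b + φ c` to a nonnegative P-side mass. -/
theorem linZP_ge_three (D : Design) (φ : Cell → ℤ) (hφ : ∀ c ∈ D.suppP, 0 ≤ φ c) {a b c : Cell}
    (ha : a ∈ D.suppP) (hb : b ∈ D.suppP) (hc : c ∈ D.suppP) (hab : a ≠ b) (hac : a ≠ c) (hbc : b ≠ c) :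
    φ a + φ b + φ c ≤ linZ D.P φ := by
  classical
  have hsupp : ∀ cm ∈ D.P, 0 < cm.2 → cm.1 ∈ (D.P.map Prod.fst).toFinset ∪ {a, b, c} := fun cm hcm _ =>
    Finset.mem_union_left _ (List.mem_toFinset.2 (List.mem_map.2 ⟨cm, hcm, rfl⟩))
  rw [linZ_eq_sum D.P φ _ hsupp]
  have hsub : ({a, b, c} : Finset Cell) ⊆ (D.P.map Prod.fst).toFinset ∪ {a, b, c} := Finset.subset_union_right
  have hnn : ∀ i ∈ (D.P.map Prod.fst).toFinset ∪ {a, b, c}, i ∉ ({a, b, c} : Finset Cell) →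
      0 ≤ (mPL D.P i : ℤ) * φ i := by
    intro i _ _
    rcases Nat.eq_zero_or_pos (mPL D.P i) with h0 | hpos
    · rw [h0]; simp
    · exact mul_nonneg (by exact_mod_cast hpos.le)
        (hφ i ((mem_suppP_iff_mP_pos D i).2 (by rw [mP_eq_mPL]; exact hpos)))
  have h3 := Finset.sum_le_sum_of_subset_of_nonneg hsub hnn
  have hma : (1 : ℤ) ≤ mPL D.P a := by
    have := (mem_suppP_iff_mP_pos D a).1 ha; rw [mP_eq_mPL] at this; exact_mod_cast this
  have hmb : (1 : ℤ) ≤ mPL D.P b := by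
    have := (mem_suppP_iff_mP_pos D b).1 hb; rw [mP_eq_mPL] at this; exact_mod_cast this
  have hmc : (1 : ℤ) ≤ mPL D.P c := by
    have := (mem_suppP_iff_mP_pos D c).1 hc; rw [mP_eq_mPL] at this; exact_mod_cast this
  have hsum : ∑ i ∈ ({a, b, c} : Finset Cell), (mPL D.P i : ℤ) * φ i =
      mPL D.P a * φ a + (mPL D.P b * φ b + mPL D.P c * φ c) := by
    rw [Finset.sum_insert (by simp [hab, hac]), Finset.sum_insert (by simp [hbc]), Finset.sum_singleton]
  have la := mul_le_mul_of_nonneg_right hma (hφ a ha)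
  have lb := mul_le_mul_of_nonneg_right hmb (hφ b hb)
  have lc := mul_le_mul_of_nonneg_right hmc (hφ c hc)
  linarith

/-- **`W_P(t) ≥ 3·ψ_t(y)` (memo §2 (2a), P side).** On the height-`hgt` alphabet, with the P support inside shell `4`, RULE D and
`Disj`: for every N-support cell `y` and every box `t`, the P-side box mass is at least three times the box weight of `y` (three distinct
suppliers, each alive with weight `≥ ψ_t(y)` by the shadow law; trivially true when `y` is dead at `t`). -/
theorem linZP_psi_ge_three (hgt : ℤ) (D : Design) (hO : D.OnAlphabet hgt)
    (h4 : ∀ c ∈ D.suppP, ∀ f : Fin 4, hgt - 4 ≤ (c f).a) (hR : RuleD D) (hdis : Disj D)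
    (t : Fin 4 → Fin 4) (y : Cell) (hy : y ∈ D.suppN) : 3 * psi hgt t y ≤ linZ D.P (psi hgt t) := by
  have hyO : ∀ f : Fin 4, (y f).OnAlphabet hgt := fun f => hO y (List.mem_append.2 (Or.inl hy)) f
  have hPO : ∀ c ∈ D.suppP, ∀ f : Fin 4, (c f).OnAlphabet hgt := fun c hc f => hO c (List.mem_append.2 (Or.inr hc)) f
  rcases le_or_gt (psi hgt t y) 0 with hle | hpos
  · have := linZP_psi_nonneg hgt D hO t
    linarith
  · have hdet := detects_of_psi_pos hgt t y hyO hpos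
    obtain ⟨a, b, c, ha, hb, hc, hab, hac, hbc, ⟨ga, ja, sa⟩, ⟨gb, jb, sb⟩, ⟨gc, jc, sc⟩⟩ :=
      three_suppliers D hR hdis y hy fun g j _ => hdet g j
    have la := psi_le_of_supplies hgt sa hyO (h4 a ha) t
    have lb := psi_le_of_supplies hgt sb hyO (h4 b hb) t
    have lc := psi_le_of_supplies hgt sc hyO (h4 c hc) t
    have h3 := linZP_ge_three D (psi hgt t) (fun c hc => psi_nonneg hgt t c (hPO c hc)) ha hb hc hab hac hbc
    linarith

/-- **PER-BOX LAW (memo §2 (2a)), every box.** `2·W_N(t) ≥ 6·ψ_t(y) + (2σ − Re(i^{|t|} μ))` for every N-support cell `y`: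
the box identity plus `W_P(t) ≥ 3ψ_t(y)`. -/
theorem perBox_law (hgt : ℤ) (D : Design) (hO : D.OnAlphabet hgt) (hA : A1e D)
    (h4 : ∀ c ∈ D.suppP, ∀ f : Fin 4, hgt - 4 ≤ (c f).a) (hR : RuleD D) (hdis : Disj D)
    (t : Fin 4 → Fin 4) (y : Cell) (hy : y ∈ D.suppN) :
    6 * psi hgt t y + (2 * Sigma hgt D - (ipow (wt t) * D.mu).re) ≤ 2 * linZ D.N (psi hgt t) := by
  have hb := box_identity hgt D hA t
  have h3 := linZP_psi_ge_three hgt D hO h4 hR hdis t y hy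
  unfold Psi at hb
  omega

/-- If the N side is DEAD at a box (`W_N(t) = 0`) then `2·W_P(t) = Re(i^{|t|} μ) − 2σ` exactly (memo §2 (2a), last clause). -/
theorem linZP_of_Ndead (hgt : ℤ) (D : Design) (hA : A1e D) (t : Fin 4 → Fin 4) (hdead : linZ D.N (psi hgt t) = 0) :
    2 * linZ D.P (psi hgt t) = (ipow (wt t) * D.mu).re - 2 * Sigma hgt D := by
  have hb := box_identity hgt D hA t
  unfold Psi at hb
  omega

/-- **FOUR-PER-BOX, mass form (BRANCH A′).** On every box `x` of the good class, `W_N(x) ≥ 16 + 3·ψ_x(y)` for every N-support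
cell `y` (in units of `16`: `M_N ≥ n + 3·w` with `n ≥ 1`). -/
theorem classA_Nmass_three (hgt : ℤ) (D : Design) (hO : D.OnAlphabet hgt) (hA : A1e D)
    (h4 : ∀ c ∈ D.suppP, ∀ f : Fin 4, hgt - 4 ≤ (c f).a) (hR : RuleD D) (hdis : Disj D) (k : Fin 4)
    (hpos : 0 < 2 * Sigma hgt D - (ipow k * D.mu).re) (x : Fin 4 → Fin 4) (hx : wt x = k)
    (y : Cell) (hy : y ∈ D.suppN) : 16 + 3 * psi hgt x y ≤ linZ D.N (psi hgt x) := by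
  have h1 := classA_Nmass hgt D hO hA k hpos x hx
  have h3 := linZP_psi_ge_three hgt D hO h4 hR hdis x y hy
  omega

/-- The ALIVE N COUNT at a box: `M_N(x) = Σ_{N cells alive at x} m`. -/
def aliveN (hgt : ℤ) (x : Fin 4 → Fin 4) (D : Design) : ℤ :=
  linZ D.N (fun c => if 0 < psi hgt x c then 1 else 0)

/-- `W_N(x) ≤ w* · M_N(x)` when every N-support cell has box weight `≤ w*`. -/
theorem linZN_psi_le_mul_aliveN (hgt : ℤ) (D : Design) (x : Fin 4 → Fin 4) (M : ℤ)
    (hmax : ∀ c ∈ D.suppN, psi hgt x c ≤ M) : linZ D.N (psi hgt x) ≤ M * aliveN hgt x D := by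
  unfold aliveN
  rw [← linZ_const_mul]
  refine linZ_mono _ _ _ fun cm hcm hpos => ?_
  obtain ⟨c, m⟩ := cm
  have hc : c ∈ D.suppN := (mem_suppN_iff D c).2 ⟨m, hcm, hpos⟩
  by_cases h : 0 < psi hgt x c
  · simp only [h, if_true, mul_one]; exact hmax c hc
  · simp only [h, if_false, mul_zero]; exact not_lt.1 h

/-- **FOUR-PER-BOX LAW (memo §2 (2a)).** In BRANCH A′, on every box of the good class at least FOUR N copies are alive:
if `y` is a heaviest alive N cell at `x` (`ψ_x(y) = w* > 0`), then `w*·M_N ≥ W_N ≥ 16 + 3w*`, so `M_N ≥ 4`. -/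
theorem four_per_box (hgt : ℤ) (D : Design) (hO : D.OnAlphabet hgt) (hA : A1e D)
    (h4 : ∀ c ∈ D.suppP, ∀ f : Fin 4, hgt - 4 ≤ (c f).a) (hR : RuleD D) (hdis : Disj D) (k : Fin 4)
    (hpos : 0 < 2 * Sigma hgt D - (ipow k * D.mu).re) (x : Fin 4 → Fin 4) (hx : wt x = k)
    (y : Cell) (hy : y ∈ D.suppN) (hypos : 0 < psi hgt x y) (hmax : ∀ c ∈ D.suppN, psi hgt x c ≤ psi hgt x y) :
    4 ≤ aliveN hgt x D := by
  have h1 := classA_Nmass_three hgt D hO hA h4 hR hdis k hpos x hx y hy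
  have h2 := linZN_psi_le_mul_aliveN hgt D x (psi hgt x y) hmax
  by_contra hlt
  have hle : aliveN hgt x D ≤ 3 := by omega
  have := mul_le_mul_of_nonneg_left hle hypos.le
  linarith

/-- The same count on ANY box: `2·w*·M_N(x) ≥ 6·w* + (2σ − Re(i^{|x|} μ))` whenever every N-support cell has box weight `≤ w* = ψ_x(y)`
for some N-support cell `y` (memo §2 (2a): `M_N ≥ 3 + n∕w*` in units of `16`). -/
theorem aliveN_law (hgt : ℤ) (D : Design) (hO : D.OnAlphabet hgt) (hA : A1e D)
    (h4 : ∀ c ∈ D.suppP, ∀ f : Fin 4, hgt - 4 ≤ (c f).a) (hR : RuleD D) (hdis : Disj D)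
    (x : Fin 4 → Fin 4) (y : Cell) (hy : y ∈ D.suppN)
    (hmax : ∀ c ∈ D.suppN, psi hgt x c ≤ psi hgt x y) :
    6 * psi hgt x y + (2 * Sigma hgt D - (ipow (wt x) * D.mu).re) ≤ 2 * (psi hgt x y * aliveN hgt x D) := by
  have h1 := perBox_law hgt D hO hA h4 hR hdis x y hy
  have h2 := linZN_psi_le_mul_aliveN hgt D x (psi hgt x y) hmax
  linarith


/-! ## §12 THE FACE IDENTITIES (negation g22; memo `FOURFOLD-negation-g22.md` §4)

For a PROPER face `F ⊊ {0,1,2,3}` (a Boolean mask with some free slot) and any phase vector `x`, put `ψ^F_x(c) = ∏_{f ∈ F} slab_(x_f)(c_f)`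
and `ρ^F(c) = ∏_{f ∈ F} (hgt − a_f)`. Under CLAUSE 1 of (A1) alone: `Σ_N m·ψ^F_x − Σ_P m·ψ^F_x = Σ_N m·ρ^F − Σ_P m·ρ^F` EXACTLY — no
`μ`-term (the Bloch words `eeee`, `ēēēē` need all four slots) and no dependence on `x`. The slot table is the box table on `F` and the
unit table `un` (`1 ↦ 2`, else `0`) on the free slots. -/

/-- The UNIT slot table: `1 ↦ 2`, every other symbol `↦ 0`; its letter functional reads the constant `2`. -/
def un : Sym → GaussianInt
  | Sym.one => 2
  | Sym.h => 0
  | Sym.e => 0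
  | Sym.ebar => 0
  | Sym.pt => 0

/-- The integer slot reading of a face table: `slab_(x_f)` on `F`, `1` off `F`. -/
def gF (hgt : ℤ) (F : Fin 4 → Bool) (x : Fin 4 → Fin 4) (f : Fin 4) (ℓ : Letter) : ℤ :=
  if F f = true then slab hgt (x f) ℓ else 1

/-- The e-free slot reading: `hgt − a` on `F`, `1` off `F`. -/
def gF0 (hgt : ℤ) (F : Fin 4 → Bool) (f : Fin 4) (ℓ : Letter) : ℤ :=
  if F f = true then hgt - ℓ.a else 1

/-- `ψ^F_x(c) = ∏_{f ∈ F} slab_(x_f)(c_f)`. -/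
def psiF (hgt : ℤ) (F : Fin 4 → Bool) (x : Fin 4 → Fin 4) (c : Cell) : ℤ := ∏ f : Fin 4, gF hgt F x f (c f)

/-- `ρ^F(c) = ∏_{f ∈ F} (hgt − a_f)`. -/
def rhoF (hgt : ℤ) (F : Fin 4 → Bool) (c : Cell) : ℤ := ∏ f : Fin 4, gF0 hgt F f (c f)

/-- `Ψ^F_x(D) = Σ_N m·ψ^F_x − Σ_P m·ψ^F_x`. -/
def PsiF (hgt : ℤ) (F : Fin 4 → Bool) (x : Fin 4 → Fin 4) (D : Design) : ℤ :=
  linZ D.N (psiF hgt F x) - linZ D.P (psiF hgt F x)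

/-- `Σ^F(D) = Σ_N m·ρ^F − Σ_P m·ρ^F` (`= T(C^{⊗F} ⊗ 1^{⊗F^c})`, the `σ_k` of the memo for `|F| = k`). -/
def SigmaF (hgt : ℤ) (F : Fin 4 → Bool) (D : Design) : ℤ := linZ D.N (rhoF hgt F) - linZ D.P (rhoF hgt F)

/-- The FACE table: box table on `F`, unit table off `F`. -/
def Ftab (hgt : ℤ) (F : Fin 4 → Bool) (x : Fin 4 → Fin 4) : Tab := fun f => if F f = true then bx hgt (x f) else un

theorem read_un (ℓ : Letter) : ∑ s : Sym, un s * s.coef ℓ = ((2 * 1 : ℤ) : GaussianInt) := by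
  rw [sum_sym]
  simp [un, Sym.coef]

theorem read_un0 (ℓ : Letter) : ∑ s : Sym, (if s.efree = true then un s else 0) * s.coef ℓ = ((2 * 1 : ℤ) : GaussianInt) := by
  rw [sum_sym]
  simp [un, Sym.efree, Sym.coef]

theorem G_Ftab (hgt : ℤ) (F : Fin 4 → Bool) (x : Fin 4 → Fin 4) (f : Fin 4) (ℓ : Letter) :
    G (Ftab hgt F x) f ℓ = ((2 * gF hgt F x f ℓ : ℤ) : GaussianInt) := by
  unfold G Ftab gF
  by_cases hF : F f = true
  · simp only [hF, if_true]; exact read_bx hgt (x f) ℓ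
  · simp only [hF]; exact read_un ℓ

theorem G_trunc_Ftab (hgt : ℤ) (F : Fin 4 → Bool) (x : Fin 4 → Fin 4) (f : Fin 4) (ℓ : Letter) :
    G (trunc (Ftab hgt F x)) f ℓ = ((2 * gF0 hgt F f ℓ : ℤ) : GaussianInt) := by
  unfold G trunc Ftab gF0
  by_cases hF : F f = true
  · simp only [hF, if_true]; exact read_bx0 hgt (x f) ℓ
  · simp only [hF]; exact read_un0 ℓ

theorem prod_G_Ftab (hgt : ℤ) (F : Fin 4 → Bool) (x : Fin 4 → Fin 4) (c : Cell) :
    ∏ f : Fin 4, G (Ftab hgt F x) f (c f) = ((16 * psiF hgt F x c : ℤ) : GaussianInt) := by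
  simp only [G_Ftab, psiF, Fin.prod_univ_four]
  push_cast
  ring

theorem prod_G_trunc_Ftab (hgt : ℤ) (F : Fin 4 → Bool) (x : Fin 4 → Fin 4) (c : Cell) :
    ∏ f : Fin 4, G (trunc (Ftab hgt F x)) f (c f) = ((16 * rhoF hgt F c : ℤ) : GaussianInt) := by
  simp only [G_trunc_Ftab, rhoF, Fin.prod_univ_four]
  push_cast
  ring

theorem wsum_prod_G_Ftab (hgt : ℤ) (F : Fin 4 → Bool) (x : Fin 4 → Fin 4) (Lst : List (Cell × ℕ)) :
    wsum Lst (fun c => ∏ f : Fin 4, G (Ftab hgt F x) f (c f)) = ((16 * linZ Lst (psiF hgt F x) : ℤ) : GaussianInt) := by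
  have h1 : wsum Lst (fun c => ∏ f : Fin 4, G (Ftab hgt F x) f (c f))
      = wsum Lst (fun c => ((16 * psiF hgt F x c : ℤ) : GaussianInt)) := by
    unfold wsum
    congr 1
    refine List.map_congr_left fun cm _ => ?_
    simp only [prod_G_Ftab]
  rw [h1, wsum_eq_cast_linZ, linZ_const_mul]

theorem wsum_prod_G_trunc_Ftab (hgt : ℤ) (F : Fin 4 → Bool) (x : Fin 4 → Fin 4) (Lst : List (Cell × ℕ)) :
    wsum Lst (fun c => ∏ f : Fin 4, G (trunc (Ftab hgt F x)) f (c f)) = ((16 * linZ Lst (rhoF hgt F) : ℤ) : GaussianInt) := by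
  have h1 : wsum Lst (fun c => ∏ f : Fin 4, G (trunc (Ftab hgt F x)) f (c f))
      = wsum Lst (fun c => ((16 * rhoF hgt F c : ℤ) : GaussianInt)) := by
    unfold wsum
    congr 1
    refine List.map_congr_left fun cm _ => ?_
    simp only [prod_G_trunc_Ftab]
  rw [h1, wsum_eq_cast_linZ, linZ_const_mul]

/-- On a proper face the Bloch words have weight `0` (a free slot reads `un e = un ē = 0`). -/
theorem lamW_Ftab_eeee (hgt : ℤ) (F : Fin 4 → Bool) (x : Fin 4 → Fin 4) (d : Fin 4) (hd : F d = false) :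
    lamW (Ftab hgt F x) Word.eeee = 0 := by
  unfold lamW
  apply Finset.prod_eq_zero (Finset.mem_univ d)
  simp [Ftab, hd, Word.eeee, un]

theorem lamW_Ftab_EEEE (hgt : ℤ) (F : Fin 4 → Bool) (x : Fin 4 → Fin 4) (d : Fin 4) (hd : F d = false) :
    lamW (Ftab hgt F x) Word.EEEE = 0 := by
  unfold lamW
  apply Finset.prod_eq_zero (Finset.mem_univ d)
  simp [Ftab, hd, Word.EEEE, un]

/-- **THE FACE IDENTITY (every height, every proper face, every phase vector; clause 1 of (A1) only).**
`Σ_N m·ψ^F_x − Σ_P m·ψ^F_x = Σ_N m·ρ^F − Σ_P m·ρ^F`: on a `k`-face (`k ≤ 3`) the signed box mass is the `μ`-FREE constant `σ_F`,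
the same for all `4^k` phase choices on `F`. -/
theorem face_identity (hgt : ℤ) (D : Design) (hA : A1e D) (F : Fin 4 → Bool) (d : Fin 4) (hd : F d = false)
    (x : Fin 4 → Fin 4) : PsiF hgt F x D = SigmaF hgt F D := by
  have h := split (Ftab hgt F x) D hA
  rw [expand (Ftab hgt F x) D, expand (trunc (Ftab hgt F x)) D, lamW_Ftab_eeee hgt F x d hd, lamW_Ftab_EEEE hgt F x d hd,
    wsum_prod_G_Ftab, wsum_prod_G_Ftab, wsum_prod_G_trunc_Ftab, wsum_prod_G_trunc_Ftab, zero_mul, zero_mul, add_zero,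
    add_zero] at h
  unfold PsiF SigmaF
  have h' : ((16 * (linZ D.N (psiF hgt F x) - linZ D.P (psiF hgt F x)) : ℤ) : GaussianInt)
      = ((16 * (linZ D.N (rhoF hgt F) - linZ D.P (rhoF hgt F)) : ℤ) : GaussianInt) := by
    push_cast at h ⊢
    linear_combination h
  have h'' := (Int.cast_inj (α := GaussianInt)).1 h'
  omega

/-- The face identity is PHASE-FREE: `Ψ^F_x = Ψ^F_{x'}` for any two phase vectors. -/
theorem face_phase_free (hgt : ℤ) (D : Design) (hA : A1e D) (F : Fin 4 → Bool) (d : Fin 4) (hd : F d = false)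
    (x x' : Fin 4 → Fin 4) : PsiF hgt F x D = PsiF hgt F x' D := by
  rw [face_identity hgt D hA F d hd x, face_identity hgt D hA F d hd x']

/-- Mass form: `Σ_N m·ψ^F_x = σ_F + Σ_P m·ψ^F_x` with `σ_F = Σ^F(D)`; in particular (alphabet) the N side of a proper face is alive
as soon as `σ_F > 0`, the P side as soon as `σ_F < 0`. -/
theorem face_Nmass (hgt : ℤ) (D : Design) (hA : A1e D) (F : Fin 4 → Bool) (d : Fin 4) (hd : F d = false)
    (x : Fin 4 → Fin 4) : linZ D.N (psiF hgt F x) = SigmaF hgt F D + linZ D.P (psiF hgt F x) := by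
  have h := face_identity hgt D hA F d hd x
  unfold PsiF at h
  omega

/-- The full mask recovers the box weight: `ψ^{⊤}_x = ψ_x` (so `face_identity` is exactly the `μ`-free part of `box_identity`,
which needs the extra Bloch term on the 4-face). -/
theorem psiF_top (hgt : ℤ) (x : Fin 4 → Fin 4) (c : Cell) : psiF hgt (fun _ => true) x c = psi hgt x c := by
  simp [psiF, psi, gF]

/-- Sanity (memo §4, height 14, the 1-face `{0}` at phase `0` and the 2-face `{0,1}`): free slots contribute `1`. -/
example : psiF 14 (fun f => f = 0) (fun _ => 0) (fun _ => ⟨12, 1, 1⟩) = 0 := by decide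
example : psiF 14 (fun f => f = 0) (fun _ => 2) (fun _ => ⟨12, 1, 1⟩) = 4 := by decide
example : rhoF 14 (fun f => f = 0 ∨ f = 1) (fun _ => ⟨12, 1, 1⟩) = 4 := by decide

end Summit.HodgeConjecture.HodgeConjecture.Cruxes.BlochSeedDiscOne.BoxIdentity
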